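import Literature.Analysis.FluidPDE.TaoEnstrophyLocalisationProofs
import Literature.Analysis.FluidPDE.VorticityCalculus
import Literature.Analysis.FluidPDE.AxisymPoloidalCutoff
import Literature.Analysis.FluidPDE.EnergyToolkit
import Literature.Analysis.FluidPDE.EnergyUniqueness
import Mathlib.Analysis.Calculus.ContDiff.Bounds
import HarnessLib

/-!
# Pineau–Vicol (2026), Lemma 9.4: the fixed-slice enstrophy inequality

The spatial half of the propagation-of-small-vorticity lemma [PineauVicol2026, Lemma 9.4]
behind Theorem 1.9 (`pineauVicol2026_oneSlice_regularity`). In similarity variables the local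
enstrophy `F²(s) = ∫ χ²|Ω|²` of the profile `U(·, s)` (`Ω = curl U`, `χ = χ̄(·/R)`) obeys the
identity `d/ds F² = −½F² + E − 2D² + S` ((9.9), established in the companion time-dependent
file), with the dissipation `D² = ∫χ²|DΩ|²_F`, the cut-off error
`E = ∫(½Dη[y] + Δη + Dη[U])|Ω|²` (`η = χ²`) and the stretching `S = 2∫χ²⟨Ω, DU Ω⟩`. This file
proves, for a single slice, the inequality

  `−½F² + E − 2D² + S ≤ −¼F² + θ²/16`   (`slice_enstrophy_ineq`)

whenever `F² ≤ θ² ≤ ϑ²` (`ϑ` universal) and `R ≥ R₀(θ, C_u, K, K₂, χ̄)`, for every `C³` profile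
`U` that is divergence free on `B(0, 5R)` and satisfies the Type I bounds
`|U| ≤ C_u/(1+|y|)`, `|DU| ≤ K/(1+|y|)²`, `|D²U| ≤ K₂/(1+|y|)³` on `B̄(0, 4R)` ((9.4)–(9.5)).

Proof. The cut-off error is `O((1 + C_u)K²/R)` ((9.10), `abs_integral_Eterm_le`). For the
stretching term Pineau–Vicol use the Gagliardo–Nirenberg `L⁴` interpolation and the `L⁴`
div–curl (Calderón–Zygmund) estimate ((9.11)–(9.12)). Here the `L⁴` div–curl estimate is
replaced by `L²` identities available in the tree: with `V = χ♯U`, `χ♯ = χ̄(·/(2R))`, the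
stretching density is `≤ Σₖ |χΩ| |∂ₖV| |χΩ|` (`abs_stretch_density_le`), the trilinear
Sobolev estimate of `EnergyToolkit` (`integral_norm_mul_norm_mul_norm_le`: Cauchy–Schwarz, `L⁴`
interpolation and Mathlib's Gagliardo–Nirenberg–Sobolev inequality) bounds its integral through
`‖∂ₖV‖₂, ‖D∂ₖV‖₂, ‖χΩ‖₂ = F, ‖D(χΩ)‖₂`, and the `L²` div–curl identity
`∫|DW|²_F = ∫|curl W|² + ∫(div W)²` (`integral_frobeniusNormSq_fderiv_eq_of_hasCompactSupport`)
applied to `W = V` and to `W = ∂ₖV` (where `curl ∂ₖ = ∂ₖ curl`, `div ∂ₖ = ∂ₖ div`) reduces these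
to `F², D²` plus cut-off errors `O(R⁻¹)`, controlled pointwise on the plateau `B(0,2R)` (where
`V = U`, `div V = 0`) and on the annulus `2R ≤ |y| ≤ 4R` (Leibniz bounds and the Type I bounds).
The second-order Type I bound `K₂` (available from Corollary 9.3) enters only through the
annulus errors; the smallness structure `|S| ≤ θ a³ (3/2 F² + 27/4 D² + O(R⁻¹))`
(`abs_integral_stretch_le`, `a = K_S + 1` with `K_S` the Sobolev constant) gives the universal
`ϑ = 1/(7a³)`.

## References

* B. Pineau, V. Vicol, *On rotated backwards self-similar solutions of the incompressible 3D
  Navier–Stokes equations*, arXiv:2607.09619 (2026), Lemma 9.4 and (9.9)–(9.13), pp. 31–32.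
  [PineauVicol2026]
-/

noncomputable section

open MeasureTheory Set Function Filter Metric TopologicalSpace InnerProductSpace
open _root_.Topology
open scoped ENNReal NNReal InnerProductSpace RealInnerProductSpace Laplacian ContDiff

namespace Literature.Analysis.FluidPDE

section SliceTools

-- nested operator types
set_option maxSynthPendingDepth 3

/-- **Dilation of iterated derivatives**: `‖Dⁿ(H(b ·))(x)‖ ≤ |b|ⁿ ‖DⁿH(bx)‖`. [folklore] -/
theorem norm_iteratedFDeriv_comp_smul_le_fin3 {F : Type*} [NormedAddCommGroup F] [NormedSpace ℝ F]
    {H : EuclideanSpace ℝ (Fin 3) → F} {n : ℕ} (hH : ContDiff ℝ n H) (b : ℝ)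
    (x : EuclideanSpace ℝ (Fin 3)) :
    ‖iteratedFDeriv ℝ n (fun y => H (b • y)) x‖ ≤ |b| ^ n * ‖iteratedFDeriv ℝ n H (b • x)‖ := by
  set L : EuclideanSpace ℝ (Fin 3) →L[ℝ] EuclideanSpace ℝ (Fin 3) :=
    b • ContinuousLinearMap.id ℝ (EuclideanSpace ℝ (Fin 3)) with hL
  have e1 : (fun y => H (b • y)) = H ∘ L := by funext y; simp [hL]
  rw [e1, L.iteratedFDeriv_comp_right hH x le_rfl]
  have hLx : L x = b • x := by simp [hL]
  rw [hLx]
  refine (ContinuousMultilinearMap.norm_compContinuousLinearMap_le _ _).trans ?_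
  rw [Finset.prod_const, Finset.card_univ, Fintype.card_fin, mul_comm]
  have hLn : ‖L‖ ≤ |b| := by
    rw [hL, norm_smul, Real.norm_eq_abs]
    calc |b| * ‖ContinuousLinearMap.id ℝ (EuclideanSpace ℝ (Fin 3))‖ ≤ |b| * 1 := by
          gcongr; exact ContinuousLinearMap.norm_id_le
      _ = |b| := mul_one _
  exact mul_le_mul_of_nonneg_right (pow_le_pow_left₀ (norm_nonneg _) hLn n) (norm_nonneg _)

/-- **Derivative bounds for a dilated cut-off**: if `‖Dᵏχ̄‖ ≤ C` everywhere then
`‖Dᵏ(χ̄(ρ⁻¹ ·))(x)‖ ≤ C ρ⁻ᵏ` for `ρ > 0`. [folklore] -/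
theorem norm_iteratedFDeriv_cutoffScale_le {χb : EuclideanSpace ℝ (Fin 3) → ℝ} {n : ℕ}
    (hχ : ContDiff ℝ n χb) {C : ℝ} (hC : ∀ x, ‖iteratedFDeriv ℝ n χb x‖ ≤ C) {ρ : ℝ} (hρ : 0 < ρ)
    (x : EuclideanSpace ℝ (Fin 3)) :
    ‖iteratedFDeriv ℝ n (fun y => χb (ρ⁻¹ • y)) x‖ ≤ C / ρ ^ n := by
  refine (norm_iteratedFDeriv_comp_smul_le_fin3 hχ ρ⁻¹ x).trans ?_
  rw [abs_of_pos (inv_pos.2 hρ), inv_pow, div_eq_inv_mul]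
  exact mul_le_mul_of_nonneg_left (hC _) (by positivity)

/-- `‖D²f(x)‖ = ‖D(Df)(x)‖` for the iterated derivative. [folklore] -/
theorem norm_iteratedFDeriv_two_eq_norm_fderiv_fderiv_fin3 {F : Type*} [NormedAddCommGroup F]
    [NormedSpace ℝ F] (f : EuclideanSpace ℝ (Fin 3) → F) (x : EuclideanSpace ℝ (Fin 3)) :
    ‖iteratedFDeriv ℝ 2 f x‖ = ‖fderiv ℝ (fderiv ℝ f) x‖ := by
  rw [← norm_iteratedFDeriv_fderiv, ← norm_iteratedFDeriv_fderiv, norm_iteratedFDeriv_zero]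

/-- **Leibniz bound, first order**: `‖D(φW)(x)‖ ≤ |φ(x)| ‖DW(x)‖ + ‖Dφ(x)‖ ‖W(x)‖`. [folklore] -/
theorem norm_fderiv_smul_le_fin3 {F : Type*} [NormedAddCommGroup F] [NormedSpace ℝ F]
    {φ : EuclideanSpace ℝ (Fin 3) → ℝ}
    {W : EuclideanSpace ℝ (Fin 3) → F} {x : EuclideanSpace ℝ (Fin 3)}
    (hφ : DifferentiableAt ℝ φ x) (hW : DifferentiableAt ℝ W x) :
    ‖fderiv ℝ (fun y => φ y • W y) x‖ ≤ |φ x| * ‖fderiv ℝ W x‖ + ‖fderiv ℝ φ x‖ * ‖W x‖ := by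
  rw [fderiv_fun_smul hφ hW]
  refine (norm_add_le _ _).trans (add_le_add ?_ ?_)
  · rw [norm_smul, Real.norm_eq_abs]
  · rw [ContinuousLinearMap.norm_smulRight_apply]

/-- **Leibniz bound, second order**:
`‖D²(φW)(x)‖ ≤ |φ(x)| ‖D²W(x)‖ + 2‖Dφ(x)‖ ‖DW(x)‖ + ‖D²φ(x)‖ ‖W(x)‖`. [folklore] -/
theorem norm_iteratedFDeriv_two_smul_le {F : Type*} [NormedAddCommGroup F] [NormedSpace ℝ F]
    {φ : EuclideanSpace ℝ (Fin 3) → ℝ}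
    {W : EuclideanSpace ℝ (Fin 3) → F} (hφ : ContDiff ℝ 2 φ)
    (hW : ContDiff ℝ 2 W) (x : EuclideanSpace ℝ (Fin 3)) :
    ‖iteratedFDeriv ℝ 2 (fun y => φ y • W y) x‖ ≤
      |φ x| * ‖iteratedFDeriv ℝ 2 W x‖ + 2 * ‖fderiv ℝ φ x‖ * ‖fderiv ℝ W x‖ +
        ‖iteratedFDeriv ℝ 2 φ x‖ * ‖W x‖ := by
  have h := norm_iteratedFDeriv_smul_le (𝕜 := ℝ) hφ hW x (n := 2) le_rfl
  refine h.trans (le_of_eq ?_)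
  rw [Finset.sum_range_succ, Finset.sum_range_succ, Finset.sum_range_one]
  have e0 : ‖iteratedFDeriv ℝ 0 φ x‖ = |φ x| := by rw [norm_iteratedFDeriv_zero, Real.norm_eq_abs]
  have e1 : ‖iteratedFDeriv ℝ 1 φ x‖ = ‖fderiv ℝ φ x‖ := norm_iteratedFDeriv_one φ
  have e2 : ‖iteratedFDeriv ℝ (2 - 0) W x‖ = ‖iteratedFDeriv ℝ 2 W x‖ := rfl
  have e3 : ‖iteratedFDeriv ℝ (2 - 1) W x‖ = ‖fderiv ℝ W x‖ := norm_iteratedFDeriv_one W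
  have e4 : ‖iteratedFDeriv ℝ (2 - 2) W x‖ = ‖W x‖ := norm_iteratedFDeriv_zero
  rw [e0, e1, e2, e3, e4]
  norm_num [Nat.choose]

/-- `|tr L| ≤ ‖traceCLM‖ ‖L‖` on `ℝ³`. [folklore] -/
theorem abs_divergence_le_traceCLM (W : EuclideanSpace ℝ (Fin 3) → EuclideanSpace ℝ (Fin 3))
    (x : EuclideanSpace ℝ (Fin 3)) :
    |VectorCalculus.divergence W x| ≤
      ‖(traceCLM : (EuclideanSpace ℝ (Fin 3) →L[ℝ] EuclideanSpace ℝ (Fin 3)) →L[ℝ] ℝ)‖ *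
        ‖fderiv ℝ W x‖ := by
  rw [divergence_eq_traceCLM, ← Real.norm_eq_abs]
  exact ContinuousLinearMap.le_opNorm _ _

/-- `D(div W)(x) = traceCLM ∘ D²W(x)` for `W ∈ C²`. [folklore] -/
theorem fderiv_divergence_eq {W : EuclideanSpace ℝ (Fin 3) → EuclideanSpace ℝ (Fin 3)}
    (hW : ContDiff ℝ 2 W) (x : EuclideanSpace ℝ (Fin 3)) :
    fderiv ℝ (VectorCalculus.divergence W) x =
      (traceCLM : (EuclideanSpace ℝ (Fin 3) →L[ℝ] EuclideanSpace ℝ (Fin 3)) →L[ℝ] ℝ).comp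
        (fderiv ℝ (fderiv ℝ W) x) := by
  rw [divergence_eq_traceCLM_comp]
  have hd : DifferentiableAt ℝ (fderiv ℝ W) x :=
    ((hW.fderiv_right (m := 1) (by norm_num)).differentiable one_ne_zero).differentiableAt
  exact (traceCLM.hasFDerivAt.comp x hd.hasFDerivAt).fderiv

/-- `frobeniusNormSq L ≤ 3 ‖L‖²` on `ℝ³`. [folklore] -/
theorem frobeniusNormSq_le_three_mul_sq_opNorm {F : Type*} [NormedAddCommGroup F]
    [InnerProductSpace ℝ F] [FiniteDimensional ℝ F] (L : EuclideanSpace ℝ (Fin 3) →L[ℝ] F) :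
    frobeniusNormSq L ≤ 3 * ‖L‖ ^ 2 := by
  rw [frobeniusNormSq_eq_sum (EuclideanSpace.basisFun (Fin 3) ℝ)]
  calc ∑ i, ‖L (EuclideanSpace.basisFun (Fin 3) ℝ i)‖ ^ 2 ≤ ∑ _i : Fin 3, ‖L‖ ^ 2 := by
        refine Finset.sum_le_sum fun i _ => pow_le_pow_left₀ (norm_nonneg _) ?_ 2
        calc ‖L (EuclideanSpace.basisFun (Fin 3) ℝ i)‖ ≤ ‖L‖ * ‖EuclideanSpace.basisFun (Fin 3) ℝ i‖ :=
              L.le_opNorm _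
          _ = ‖L‖ := by rw [(EuclideanSpace.basisFun (Fin 3) ℝ).orthonormal.1 i, mul_one]
    _ = 3 * ‖L‖ ^ 2 := by simp

/-- `‖L e‖² ≤ frobeniusNormSq L` for each vector of the standard basis of `ℝ³`. [folklore] -/
theorem sq_norm_apply_basisFun_le_frobeniusNormSq {F : Type*} [NormedAddCommGroup F]
    [InnerProductSpace ℝ F] [FiniteDimensional ℝ F] (L : EuclideanSpace ℝ (Fin 3) →L[ℝ] F)
    (k : Fin 3) : ‖L (EuclideanSpace.basisFun (Fin 3) ℝ k)‖ ^ 2 ≤ frobeniusNormSq L := by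
  rw [frobeniusNormSq_eq_sum (EuclideanSpace.basisFun (Fin 3) ℝ)]
  exact Finset.single_le_sum (f := fun i => ‖L (EuclideanSpace.basisFun (Fin 3) ℝ i)‖ ^ 2)
    (fun i _ => sq_nonneg _) (Finset.mem_univ k)

/-- Deprecated `ℝ³` alias of `divergence_fderiv_apply` (`TaoEnstrophyLocalisationProofs`,
`div ∂ₖ = ∂ₖ div` for `C²` fields); kept only because a Summits theorem file still refers to
this name. [folklore] -/
@[deprecated divergence_fderiv_apply (since := "2026-08-16")]
theorem divergence_fderiv_apply_eq {V : EuclideanSpace ℝ (Fin 3) → EuclideanSpace ℝ (Fin 3)}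
    (hV : ContDiff ℝ 2 V) (x e : EuclideanSpace ℝ (Fin 3)) :
    VectorCalculus.divergence (fun y => fderiv ℝ V y e) x =
      fderiv ℝ (VectorCalculus.divergence V) x e :=
  divergence_fderiv_apply hV x e

/-- **Split of an integral of a nonnegative function supported in a ball, with a bound off a
smaller ball**: `∫ f ≤ ∫ g + M · vol(B̄(0, ρ₂))` when `0 ≤ f ≤ g + M·𝟙_{B̄(0,ρ₂)}`;
here in the pointwise-majorant form used below. [folklore] -/
theorem integral_le_of_le_add_indicator {f g : EuclideanSpace ℝ (Fin 3) → ℝ} {M ρ : ℝ}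
    (hf : Integrable f) (hg : Integrable g)
    (h : ∀ y, f y ≤ g y + (closedBall (0 : EuclideanSpace ℝ (Fin 3)) ρ).indicator (fun _ => M) y) :
    ∫ y, f y ≤ (∫ y, g y) + M * (volume (closedBall (0 : EuclideanSpace ℝ (Fin 3)) ρ)).toReal := by
  have hind : Integrable ((closedBall (0 : EuclideanSpace ℝ (Fin 3)) ρ).indicator fun _ => M) := by
    refine IntegrableOn.integrable_indicator ?_ measurableSet_closedBall
    exact (integrableOn_const_iff (C := M)).2 (Or.inr measure_closedBall_lt_top)
  calc ∫ y, f y ≤ ∫ y, (g y + (closedBall (0 : EuclideanSpace ℝ (Fin 3)) ρ).indicator (fun _ => M) y) :=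
        integral_mono hf (hg.add hind) h
    _ = (∫ y, g y) + M * (volume (closedBall (0 : EuclideanSpace ℝ (Fin 3)) ρ)).toReal := by
        rw [integral_add hg hind, integral_indicator measurableSet_closedBall, setIntegral_const,
          smul_eq_mul, measureReal_def, mul_comm]

end SliceTools


section SliceMajorants

-- nested operator types
set_option maxSynthPendingDepth 3

variable {χb : EuclideanSpace ℝ (Fin 3) → ℝ}

/-! #### The scaled cut-offs `χ_ρ(y) = χ̄(y/ρ)` -/

/-- `χ̄(y/ρ) = 1` for `|y| ≤ ρ`. [folklore] -/
theorem cutoffScale_eq_one (hχb1 : ∀ x, ‖x‖ ≤ 1 → χb x = 1) {ρ : ℝ} (hρ : 0 < ρ)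
    {y : EuclideanSpace ℝ (Fin 3)} (hy : ‖y‖ ≤ ρ) : χb (ρ⁻¹ • y) = 1 := by
  refine hχb1 _ ?_
  rw [norm_smul, Real.norm_of_nonneg (inv_nonneg.2 hρ.le), inv_mul_le_iff₀ hρ]
  simpa using hy

/-- `χ̄(y/ρ) = 0` for `|y| ≥ 2ρ`. [folklore] -/
theorem cutoffScale_eq_zero (hχb0 : ∀ x, 2 ≤ ‖x‖ → χb x = 0) {ρ : ℝ} (hρ : 0 < ρ)
    {y : EuclideanSpace ℝ (Fin 3)} (hy : 2 * ρ ≤ ‖y‖) : χb (ρ⁻¹ • y) = 0 := by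
  refine hχb0 _ ?_
  rw [norm_smul, Real.norm_of_nonneg (inv_nonneg.2 hρ.le), le_inv_mul_iff₀ hρ]
  linarith

/-- `χ̄(·/ρ) = 1` near every point of the open ball `B(0, ρ)`. [folklore] -/
theorem cutoffScale_eventuallyEq_one (hχb1 : ∀ x, ‖x‖ ≤ 1 → χb x = 1) {ρ : ℝ} (hρ : 0 < ρ)
    {y : EuclideanSpace ℝ (Fin 3)} (hy : ‖y‖ < ρ) :
    (fun z => χb (ρ⁻¹ • z)) =ᶠ[𝓝 y] fun _ => (1 : ℝ) := by
  filter_upwards [isOpen_ball.mem_nhds (mem_ball_zero_iff.2 hy)] with z hz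
  exact cutoffScale_eq_one hχb1 hρ (mem_ball_zero_iff.1 hz).le

/-- `χ̄(·/ρ) = 0` near every point with `|y| > 2ρ`. [folklore] -/
theorem cutoffScale_eventuallyEq_zero (hχb0 : ∀ x, 2 ≤ ‖x‖ → χb x = 0) {ρ : ℝ} (hρ : 0 < ρ)
    {y : EuclideanSpace ℝ (Fin 3)} (hy : 2 * ρ < ‖y‖) :
    (fun z => χb (ρ⁻¹ • z)) =ᶠ[𝓝 y] fun _ => (0 : ℝ) := by
  have ho : IsOpen {z : EuclideanSpace ℝ (Fin 3) | 2 * ρ < ‖z‖} :=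
    isOpen_lt continuous_const continuous_norm
  filter_upwards [ho.mem_nhds hy] with z hz
  exact cutoffScale_eq_zero hχb0 hρ (le_of_lt hz)

/-- First-derivative bound of the scaled cut-off: `‖D(χ̄(·/ρ))‖ ≤ C₁/ρ`. [folklore] -/
theorem norm_fderiv_cutoffScale_le (hχb : ContDiff ℝ 1 χb) {C₁ : ℝ}
    (hC₁ : ∀ x, ‖fderiv ℝ χb x‖ ≤ C₁) {ρ : ℝ} (hρ : 0 < ρ) (y : EuclideanSpace ℝ (Fin 3)) :
    ‖fderiv ℝ (fun z => χb (ρ⁻¹ • z)) y‖ ≤ C₁ / ρ := by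
  have h := norm_iteratedFDeriv_cutoffScale_le (n := 1) hχb
    (fun x => by rw [norm_iteratedFDeriv_one]; exact hC₁ x) hρ y
  rwa [norm_iteratedFDeriv_one, pow_one] at h

/-- Second-derivative bound of the scaled cut-off: `‖D²(χ̄(·/ρ))‖ ≤ C₂/ρ²`. [folklore] -/
theorem norm_iteratedFDeriv_two_cutoffScale_le (hχb : ContDiff ℝ 2 χb) {C₂ : ℝ}
    (hC₂ : ∀ x, ‖iteratedFDeriv ℝ 2 χb x‖ ≤ C₂) {ρ : ℝ} (hρ : 0 < ρ) (y : EuclideanSpace ℝ (Fin 3)) :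
    ‖iteratedFDeriv ℝ 2 (fun z => χb (ρ⁻¹ • z)) y‖ ≤ C₂ / ρ ^ 2 :=
  norm_iteratedFDeriv_cutoffScale_le (n := 2) hχb hC₂ hρ y

/-- `|χ̄(y/ρ)| ≤ 1`. [folklore] -/
theorem abs_cutoffScale_le (hχb01 : ∀ x, |χb x| ≤ 1) (ρ : ℝ) (y : EuclideanSpace ℝ (Fin 3)) :
    |χb (ρ⁻¹ • y)| ≤ 1 := hχb01 _

/-! #### The cut-off profile `V = χ♯ U`, `χ♯ = χ̄(·/(2R))` -/

variable {U V : EuclideanSpace ℝ (Fin 3) → EuclideanSpace ℝ (Fin 3)}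
  {χS : EuclideanSpace ℝ (Fin 3) → ℝ} {R : ℝ}

/-- `V = U` near every point of `B(0, 2R)`. [folklore] -/
theorem sliceV_eventuallyEq (hχb1 : ∀ x, ‖x‖ ≤ 1 → χb x = 1) (hR : 0 < R)
    (hχS : χS = fun y => χb ((2 * R)⁻¹ • y)) (hV : V = fun y => χS y • U y)
    {y : EuclideanSpace ℝ (Fin 3)} (hy : ‖y‖ < 2 * R) : V =ᶠ[𝓝 y] U := by
  have h := cutoffScale_eventuallyEq_one hχb1 (by positivity : 0 < 2 * R) hy
  filter_upwards [h] with z hz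
  rw [hV, hχS]
  show χb ((2 * R)⁻¹ • z) • U z = U z
  rw [hz, one_smul]

/-- `V = 0` near every point with `|y| > 4R`. [folklore] -/
theorem sliceV_eventuallyEq_zero (hχb0 : ∀ x, 2 ≤ ‖x‖ → χb x = 0) (hR : 0 < R)
    (hχS : χS = fun y => χb ((2 * R)⁻¹ • y)) (hV : V = fun y => χS y • U y)
    {y : EuclideanSpace ℝ (Fin 3)} (hy : 4 * R < ‖y‖) :
    V =ᶠ[𝓝 y] fun _ => (0 : EuclideanSpace ℝ (Fin 3)) := by
  have h := cutoffScale_eventuallyEq_zero hχb0 (by positivity : 0 < 2 * R) (y := y) (by linarith)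
  filter_upwards [h] with z hz
  rw [hV, hχS]
  show χb ((2 * R)⁻¹ • z) • U z = 0
  rw [hz, zero_smul]

/-- `V` is `C³`. [folklore] -/
theorem sliceV_contDiff (hχb : ContDiff ℝ 3 χb) (hU : ContDiff ℝ 3 U)
    (hχS : χS = fun y => χb ((2 * R)⁻¹ • y)) (hV : V = fun y => χS y • U y) :
    ContDiff ℝ 3 V := by
  rw [hV, hχS]
  exact (hχb.comp (contDiff_const_smul _)).smul hU

/-- `V` is supported in `B̄(0, 4R)`. [folklore] -/
theorem sliceV_hasCompactSupport (hχb0 : ∀ x, 2 ≤ ‖x‖ → χb x = 0) (hR : 0 < R)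
    (hχS : χS = fun y => χb ((2 * R)⁻¹ • y)) (hV : V = fun y => χS y • U y) :
    HasCompactSupport V := by
  refine HasCompactSupport.intro (isCompact_closedBall (0 : EuclideanSpace ℝ (Fin 3)) (4 * R))
    fun y hy => ?_
  rw [mem_closedBall_zero_iff, not_le] at hy
  rw [hV, hχS]
  simp only
  rw [cutoffScale_eq_zero hχb0 (by positivity : 0 < 2 * R) (by linarith), zero_smul]

/-- `V` vanishes outside `B̄(0, 4R)`, with all its derivatives: `DV = 0` and `D²`-quantities
vanish for `|y| > 4R`. [folklore] -/
theorem sliceV_fderiv_eq_zero (hχb0 : ∀ x, 2 ≤ ‖x‖ → χb x = 0) (hR : 0 < R)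
    (hχS : χS = fun y => χb ((2 * R)⁻¹ • y)) (hV : V = fun y => χS y • U y)
    {y : EuclideanSpace ℝ (Fin 3)} (hy : 4 * R < ‖y‖) :
    fderiv ℝ V y = 0 ∧ fderiv ℝ (curl V) y = 0 ∧
      fderiv ℝ (VectorCalculus.divergence V) y = 0 := by
  have h0 := sliceV_eventuallyEq_zero hχb0 hR hχS hV hy
  have hD : fderiv ℝ V =ᶠ[𝓝 y] fun _ => (0 : EuclideanSpace ℝ (Fin 3) →L[ℝ] EuclideanSpace ℝ (Fin 3)) := by
    have := h0.fderiv (𝕜 := ℝ)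
    refine this.trans ?_
    filter_upwards with z
    exact fderiv_const_apply _
  refine ⟨by rw [hD.eq_of_nhds], ?_, ?_⟩
  · have hc : curl V =ᶠ[𝓝 y] fun _ => (0 : EuclideanSpace ℝ (Fin 3)) := by
      filter_upwards [hD] with z hz
      rw [curl_eq_curlCLM, hz, map_zero]
    rw [hc.fderiv_eq, fderiv_const_apply]
  · have hc : VectorCalculus.divergence V =ᶠ[𝓝 y] fun _ => (0 : ℝ) := by
      filter_upwards [hD] with z hz
      rw [divergence_eq_traceCLM, hz, map_zero]
    rw [hc.fderiv_eq, fderiv_const_apply]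

/-- **Derivative bounds of `V = χ♯U` on the annulus `2R ≤ |y| ≤ 4R`** (Leibniz and the
Type I bounds at distance `≥ 2R`): `‖DV‖ ≤ (K + C₁C_u)/R²`,
`‖D²V‖ ≤ (K₂ + 2C₁K + C₂C_u)/R³`. [folklore] -/
theorem sliceV_norm_fderiv_le_annulus (hχb : ContDiff ℝ 3 χb) (hχb01 : ∀ x, |χb x| ≤ 1)
    {C₁ C₂ : ℝ} (hC₁0 : 0 ≤ C₁) (hC₂0 : 0 ≤ C₂) (hC₁ : ∀ x, ‖fderiv ℝ χb x‖ ≤ C₁)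
    (hC₂ : ∀ x, ‖iteratedFDeriv ℝ 2 χb x‖ ≤ C₂) (hR : 1 ≤ R)
    (hU : ContDiff ℝ 3 U) {Cu K K₂ : ℝ} (hCu : 0 ≤ Cu) (hK : 0 ≤ K) (hK₂ : 0 ≤ K₂)
    (h0 : ∀ y : EuclideanSpace ℝ (Fin 3), ‖y‖ ≤ 4 * R → ‖U y‖ ≤ Cu / (1 + ‖y‖))
    (h1 : ∀ y : EuclideanSpace ℝ (Fin 3), ‖y‖ ≤ 4 * R → ‖fderiv ℝ U y‖ ≤ K / (1 + ‖y‖) ^ 2)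
    (h2 : ∀ y : EuclideanSpace ℝ (Fin 3), ‖y‖ ≤ 4 * R →
      ‖iteratedFDeriv ℝ 2 U y‖ ≤ K₂ / (1 + ‖y‖) ^ 3)
    (hχS : χS = fun y => χb ((2 * R)⁻¹ • y)) (hV : V = fun y => χS y • U y)
    {y : EuclideanSpace ℝ (Fin 3)} (hy1 : 2 * R ≤ ‖y‖) (hy2 : ‖y‖ ≤ 4 * R) :
    ‖fderiv ℝ V y‖ ≤ (K + C₁ * Cu) / R ^ 2 ∧
      ‖iteratedFDeriv ℝ 2 V y‖ ≤ (K₂ + 2 * C₁ * K + C₂ * Cu) / R ^ 3 := by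
  have hR0 : 0 < R := by linarith
  have h2R : 0 < 2 * R := by positivity
  have hχS2 : ContDiff ℝ 2 χS := by rw [hχS]; exact (hχb.of_le (by norm_num)).comp (contDiff_const_smul _)
  have hU2 : ContDiff ℝ 2 U := hU.of_le (by norm_num)
  -- the bounds at `y`
  have hy1' : R ≤ 1 + ‖y‖ := by linarith
  have hRy : R ^ 2 ≤ (1 + ‖y‖) ^ 2 := pow_le_pow_left₀ hR0.le hy1' 2
  have hRy3 : R ^ 3 ≤ (1 + ‖y‖) ^ 3 := pow_le_pow_left₀ hR0.le hy1' 3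
  have bU : ‖U y‖ ≤ Cu / R :=
    (h0 y hy2).trans (div_le_div_of_nonneg_left hCu hR0 hy1')
  have bDU : ‖fderiv ℝ U y‖ ≤ K / R ^ 2 :=
    (h1 y hy2).trans (div_le_div_of_nonneg_left hK (by positivity) hRy)
  have bD2U : ‖iteratedFDeriv ℝ 2 U y‖ ≤ K₂ / R ^ 3 :=
    (h2 y hy2).trans (div_le_div_of_nonneg_left hK₂ (by positivity) hRy3)
  have bχ : |χS y| ≤ 1 := by rw [hχS]; exact hχb01 _
  have bDχ : ‖fderiv ℝ χS y‖ ≤ C₁ / R := by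
    rw [hχS]
    refine (norm_fderiv_cutoffScale_le (hχb.of_le (by norm_num)) hC₁ h2R y).trans ?_
    exact div_le_div_of_nonneg_left hC₁0 hR0 (by linarith)
  have bD2χ : ‖iteratedFDeriv ℝ 2 χS y‖ ≤ C₂ / R ^ 2 := by
    rw [hχS]
    refine (norm_iteratedFDeriv_two_cutoffScale_le (hχb.of_le (by norm_num)) hC₂ h2R y).trans ?_
    exact div_le_div_of_nonneg_left hC₂0 (by positivity) (by nlinarith)
  constructor
  · rw [hV]
    refine (norm_fderiv_smul_le_fin3 (hχS2.differentiable (by norm_num) y)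
      (hU2.differentiable (by norm_num) y)).trans ?_
    calc |χS y| * ‖fderiv ℝ U y‖ + ‖fderiv ℝ χS y‖ * ‖U y‖
        ≤ 1 * (K / R ^ 2) + (C₁ / R) * (Cu / R) := by gcongr
      _ = (K + C₁ * Cu) / R ^ 2 := by field_simp
  · rw [hV]
    refine (norm_iteratedFDeriv_two_smul_le hχS2 hU2 y).trans ?_
    calc |χS y| * ‖iteratedFDeriv ℝ 2 U y‖ + 2 * ‖fderiv ℝ χS y‖ * ‖fderiv ℝ U y‖ +
          ‖iteratedFDeriv ℝ 2 χS y‖ * ‖U y‖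
        ≤ 1 * (K₂ / R ^ 3) + 2 * (C₁ / R) * (K / R ^ 2) + (C₂ / R ^ 2) * (Cu / R) := by gcongr
      _ = (K₂ + 2 * C₁ * K + C₂ * Cu) / R ^ 3 := by field_simp

end SliceMajorants


section SliceMajorants2

-- nested operator types
set_option maxSynthPendingDepth 3

variable {χb : EuclideanSpace ℝ (Fin 3) → ℝ} {U V : EuclideanSpace ℝ (Fin 3) → EuclideanSpace ℝ (Fin 3)}
  {χS χ : EuclideanSpace ℝ (Fin 3) → ℝ} {R C₁ C₂ Cu K K₂ : ℝ}

/-- `K/(1+|y|)ᵐ ≤ K/Rᵐ` when `R ≤ 1 + |y|`. [folklore] -/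
theorem typeI_bound_le_of_le {K R : ℝ} (hK : 0 ≤ K) (hR : 0 < R) {y : EuclideanSpace ℝ (Fin 3)}
    (hy : R ≤ 1 + ‖y‖) (m : ℕ) : K / (1 + ‖y‖) ^ m ≤ K / R ^ m :=
  div_le_div_of_nonneg_left hK (by positivity) (pow_le_pow_left₀ hR.le hy m)

/-- **Majorant of `|curl V|²`**: `‖curl V‖² ≤ χ²‖curl U‖² + M_c 𝟙_{B̄(0,4R)}`,
`M_c = κ²(K + C₁C_u)²/R⁴`, `κ = ‖curlCLM‖`. [folklore] -/
theorem sq_norm_curl_sliceV_le (hχb : ContDiff ℝ 3 χb) (hχb1 : ∀ x, ‖x‖ ≤ 1 → χb x = 1)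
    (hχb0 : ∀ x, 2 ≤ ‖x‖ → χb x = 0) (hχb01 : ∀ x, |χb x| ≤ 1) (hC₁0 : 0 ≤ C₁) (hC₂0 : 0 ≤ C₂)
    (hC₁ : ∀ x, ‖fderiv ℝ χb x‖ ≤ C₁) (hC₂ : ∀ x, ‖iteratedFDeriv ℝ 2 χb x‖ ≤ C₂) (hR : 1 ≤ R)
    (hU : ContDiff ℝ 3 U) (hCu : 0 ≤ Cu) (hK : 0 ≤ K) (hK₂ : 0 ≤ K₂)
    (h0 : ∀ y : EuclideanSpace ℝ (Fin 3), ‖y‖ ≤ 4 * R → ‖U y‖ ≤ Cu / (1 + ‖y‖))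
    (h1 : ∀ y : EuclideanSpace ℝ (Fin 3), ‖y‖ ≤ 4 * R → ‖fderiv ℝ U y‖ ≤ K / (1 + ‖y‖) ^ 2)
    (h2 : ∀ y : EuclideanSpace ℝ (Fin 3), ‖y‖ ≤ 4 * R →
      ‖iteratedFDeriv ℝ 2 U y‖ ≤ K₂ / (1 + ‖y‖) ^ 3)
    (hχS : χS = fun y => χb ((2 * R)⁻¹ • y)) (hχ : χ = fun y => χb (R⁻¹ • y))
    (hV : V = fun y => χS y • U y) (y : EuclideanSpace ℝ (Fin 3)) :
    ‖curl V y‖ ^ 2 ≤ χ y ^ 2 * ‖curl U y‖ ^ 2 +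
      (closedBall (0 : EuclideanSpace ℝ (Fin 3)) (4 * R)).indicator
        (fun _ => ‖curlCLM‖ ^ 2 * ((K + C₁ * Cu) / R ^ 2) ^ 2) y := by
  have hR0 : 0 < R := by linarith
  set κ : ℝ := ‖curlCLM‖ with hκ
  have hMc : 0 ≤ κ ^ 2 * ((K + C₁ * Cu) / R ^ 2) ^ 2 := by positivity
  have hind0 : 0 ≤ (closedBall (0 : EuclideanSpace ℝ (Fin 3)) (4 * R)).indicator
      (fun _ => κ ^ 2 * ((K + C₁ * Cu) / R ^ 2) ^ 2) y :=
    Set.indicator_nonneg (fun _ _ => hMc) _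
  have hχ2 : 0 ≤ χ y ^ 2 * ‖curl U y‖ ^ 2 := by positivity
  rcases lt_or_ge ‖y‖ (2 * R) with hy2 | hy2
  · -- plateau of `χ♯`: `curl V = curl U`
    have hVU := sliceV_eventuallyEq hχb1 hR0 hχS hV hy2
    have hc : curl V y = curl U y := by rw [curl_eq_curlCLM, curl_eq_curlCLM, hVU.fderiv_eq]
    rw [hc]
    rcases lt_or_ge ‖y‖ R with hy1 | hy1
    · have hχ1 : χ y = 1 := by rw [hχ]; exact cutoffScale_eq_one hχb1 hR0 hy1.le
      rw [hχ1, one_pow, one_mul]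
      linarith
    · -- `R ≤ |y| < 2R`: the Type I bound
      have hyin : y ∈ closedBall (0 : EuclideanSpace ℝ (Fin 3)) (4 * R) :=
        mem_closedBall_zero_iff.2 (by linarith)
      rw [Set.indicator_of_mem hyin]
      have hb : ‖curl U y‖ ^ 2 ≤ κ ^ 2 * ((K + C₁ * Cu) / R ^ 2) ^ 2 := by
        have h1y := h1 y (by linarith)
        have hKR : K / (1 + ‖y‖) ^ 2 ≤ (K + C₁ * Cu) / R ^ 2 :=
          (typeI_bound_le_of_le hK hR0 (by linarith) 2).trans
            (div_le_div_of_nonneg_right (by nlinarith) (by positivity))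
        calc ‖curl U y‖ ^ 2 ≤ (κ * ‖fderiv ℝ U y‖) ^ 2 :=
              pow_le_pow_left₀ (norm_nonneg _) (norm_curl_le _ _) 2
          _ ≤ (κ * ((K + C₁ * Cu) / R ^ 2)) ^ 2 :=
              pow_le_pow_left₀ (mul_nonneg (norm_nonneg _) (norm_nonneg _))
                (mul_le_mul_of_nonneg_left (h1y.trans hKR) (norm_nonneg _)) 2
          _ = κ ^ 2 * ((K + C₁ * Cu) / R ^ 2) ^ 2 := by ring
      linarith
  · rcases le_or_gt ‖y‖ (4 * R) with hy4 | hy4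
    · -- annulus `2R ≤ |y| ≤ 4R`
      have hyin : y ∈ closedBall (0 : EuclideanSpace ℝ (Fin 3)) (4 * R) :=
        mem_closedBall_zero_iff.2 hy4
      rw [Set.indicator_of_mem hyin]
      have hDV := (sliceV_norm_fderiv_le_annulus hχb hχb01 hC₁0 hC₂0 hC₁ hC₂ hR hU hCu hK hK₂ h0
        h1 h2 hχS hV hy2 hy4).1
      have hb : ‖curl V y‖ ^ 2 ≤ κ ^ 2 * ((K + C₁ * Cu) / R ^ 2) ^ 2 := by
        calc ‖curl V y‖ ^ 2 ≤ (κ * ‖fderiv ℝ V y‖) ^ 2 :=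
              pow_le_pow_left₀ (norm_nonneg _) (norm_curl_le _ _) 2
          _ ≤ (κ * ((K + C₁ * Cu) / R ^ 2)) ^ 2 :=
              pow_le_pow_left₀ (mul_nonneg (norm_nonneg _) (norm_nonneg _))
                (mul_le_mul_of_nonneg_left hDV (norm_nonneg _)) 2
          _ = κ ^ 2 * ((K + C₁ * Cu) / R ^ 2) ^ 2 := by ring
      linarith
    · -- outside: `curl V = 0`
      have h0' := (sliceV_fderiv_eq_zero hχb0 hR0 hχS hV hy4).1
      rw [curl_eq_curlCLM, h0', map_zero, norm_zero, zero_pow two_ne_zero]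
      linarith

/-- **Majorant of `(div V)²`**: `(div V)² ≤ M_d 𝟙_{B̄(0,4R)}`, `M_d = τ²(K + C₁C_u)²/R⁴`,
`τ = ‖traceCLM‖` (`div V = div U = 0` on `B(0,2R)`). [folklore] -/
theorem sq_divergence_sliceV_le (hχb : ContDiff ℝ 3 χb) (hχb1 : ∀ x, ‖x‖ ≤ 1 → χb x = 1)
    (hχb0 : ∀ x, 2 ≤ ‖x‖ → χb x = 0) (hχb01 : ∀ x, |χb x| ≤ 1) (hC₁0 : 0 ≤ C₁) (hC₂0 : 0 ≤ C₂)
    (hC₁ : ∀ x, ‖fderiv ℝ χb x‖ ≤ C₁) (hC₂ : ∀ x, ‖iteratedFDeriv ℝ 2 χb x‖ ≤ C₂) (hR : 1 ≤ R)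
    (hU : ContDiff ℝ 3 U)
    (hdiv : ∀ y : EuclideanSpace ℝ (Fin 3), ‖y‖ < 5 * R → VectorCalculus.divergence U y = 0)
    (hCu : 0 ≤ Cu) (hK : 0 ≤ K) (hK₂ : 0 ≤ K₂)
    (h0 : ∀ y : EuclideanSpace ℝ (Fin 3), ‖y‖ ≤ 4 * R → ‖U y‖ ≤ Cu / (1 + ‖y‖))
    (h1 : ∀ y : EuclideanSpace ℝ (Fin 3), ‖y‖ ≤ 4 * R → ‖fderiv ℝ U y‖ ≤ K / (1 + ‖y‖) ^ 2)
    (h2 : ∀ y : EuclideanSpace ℝ (Fin 3), ‖y‖ ≤ 4 * R →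
      ‖iteratedFDeriv ℝ 2 U y‖ ≤ K₂ / (1 + ‖y‖) ^ 3)
    (hχS : χS = fun y => χb ((2 * R)⁻¹ • y)) (hV : V = fun y => χS y • U y)
    (y : EuclideanSpace ℝ (Fin 3)) :
    VectorCalculus.divergence V y ^ 2 ≤
      (closedBall (0 : EuclideanSpace ℝ (Fin 3)) (4 * R)).indicator
        (fun _ => ‖(traceCLM : (EuclideanSpace ℝ (Fin 3) →L[ℝ] EuclideanSpace ℝ (Fin 3)) →L[ℝ] ℝ)‖ ^ 2 *
          ((K + C₁ * Cu) / R ^ 2) ^ 2) y := by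
  have hR0 : 0 < R := by linarith
  set τ : ℝ := ‖(traceCLM : (EuclideanSpace ℝ (Fin 3) →L[ℝ] EuclideanSpace ℝ (Fin 3)) →L[ℝ] ℝ)‖
    with hτ
  have hMd : 0 ≤ τ ^ 2 * ((K + C₁ * Cu) / R ^ 2) ^ 2 := by positivity
  have hind0 : 0 ≤ (closedBall (0 : EuclideanSpace ℝ (Fin 3)) (4 * R)).indicator
      (fun _ => τ ^ 2 * ((K + C₁ * Cu) / R ^ 2) ^ 2) y :=
    Set.indicator_nonneg (fun _ _ => hMd) _
  rcases lt_or_ge ‖y‖ (2 * R) with hy2 | hy2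
  · have hVU := sliceV_eventuallyEq hχb1 hR0 hχS hV hy2
    have hd : VectorCalculus.divergence V y = 0 := by
      rw [divergence_eq_traceCLM, hVU.fderiv_eq, ← divergence_eq_traceCLM]
      exact hdiv y (by linarith)
    rw [hd, zero_pow two_ne_zero]
    exact hind0
  · rcases le_or_gt ‖y‖ (4 * R) with hy4 | hy4
    · have hyin : y ∈ closedBall (0 : EuclideanSpace ℝ (Fin 3)) (4 * R) :=
        mem_closedBall_zero_iff.2 hy4
      rw [Set.indicator_of_mem hyin]
      have hDV := (sliceV_norm_fderiv_le_annulus hχb hχb01 hC₁0 hC₂0 hC₁ hC₂ hR hU hCu hK hK₂ h0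
        h1 h2 hχS hV hy2 hy4).1
      calc VectorCalculus.divergence V y ^ 2 = |VectorCalculus.divergence V y| ^ 2 := (sq_abs _).symm
        _ ≤ (τ * ‖fderiv ℝ V y‖) ^ 2 :=
            pow_le_pow_left₀ (abs_nonneg _) (abs_divergence_le_traceCLM V y) 2
        _ ≤ (τ * ((K + C₁ * Cu) / R ^ 2)) ^ 2 :=
            pow_le_pow_left₀ (mul_nonneg (norm_nonneg _) (norm_nonneg _))
              (mul_le_mul_of_nonneg_left hDV (norm_nonneg _)) 2
        _ = τ ^ 2 * ((K + C₁ * Cu) / R ^ 2) ^ 2 := by ring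
    · have h0' := (sliceV_fderiv_eq_zero hχb0 hR0 hχS hV hy4).1
      rw [divergence_eq_traceCLM, h0', map_zero, zero_pow two_ne_zero]
      exact hind0

/-- **Majorant of `|D(curl V)|²_F`**: `|D(curl V)|²_F ≤ χ²|D(curl U)|²_F + M 𝟙_{B̄(0,4R)}`,
`M = 3κ²(K₂ + 2C₁K + C₂C_u)²/R⁶`. [folklore] -/
theorem frobeniusNormSq_fderiv_curl_sliceV_le (hχb : ContDiff ℝ 3 χb)
    (hχb1 : ∀ x, ‖x‖ ≤ 1 → χb x = 1)
    (hχb0 : ∀ x, 2 ≤ ‖x‖ → χb x = 0) (hχb01 : ∀ x, |χb x| ≤ 1) (hC₁0 : 0 ≤ C₁) (hC₂0 : 0 ≤ C₂)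
    (hC₁ : ∀ x, ‖fderiv ℝ χb x‖ ≤ C₁) (hC₂ : ∀ x, ‖iteratedFDeriv ℝ 2 χb x‖ ≤ C₂) (hR : 1 ≤ R)
    (hU : ContDiff ℝ 3 U) (hCu : 0 ≤ Cu) (hK : 0 ≤ K) (hK₂ : 0 ≤ K₂)
    (h0 : ∀ y : EuclideanSpace ℝ (Fin 3), ‖y‖ ≤ 4 * R → ‖U y‖ ≤ Cu / (1 + ‖y‖))
    (h1 : ∀ y : EuclideanSpace ℝ (Fin 3), ‖y‖ ≤ 4 * R → ‖fderiv ℝ U y‖ ≤ K / (1 + ‖y‖) ^ 2)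
    (h2 : ∀ y : EuclideanSpace ℝ (Fin 3), ‖y‖ ≤ 4 * R →
      ‖iteratedFDeriv ℝ 2 U y‖ ≤ K₂ / (1 + ‖y‖) ^ 3)
    (hχS : χS = fun y => χb ((2 * R)⁻¹ • y)) (hχ : χ = fun y => χb (R⁻¹ • y))
    (hV : V = fun y => χS y • U y) (y : EuclideanSpace ℝ (Fin 3)) :
    frobeniusNormSq (fderiv ℝ (curl V) y) ≤ χ y ^ 2 * frobeniusNormSq (fderiv ℝ (curl U) y) +
      (closedBall (0 : EuclideanSpace ℝ (Fin 3)) (4 * R)).indicator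
        (fun _ => 3 * ‖curlCLM‖ ^ 2 * ((K₂ + 2 * C₁ * K + C₂ * Cu) / R ^ 3) ^ 2) y := by
  have hR0 : 0 < R := by linarith
  set κ : ℝ := ‖curlCLM‖ with hκ
  have hU2 : ContDiff ℝ 2 U := hU.of_le (by norm_num)
  have hV2 : ContDiff ℝ 2 V := (sliceV_contDiff hχb hU hχS hV).of_le (by norm_num)
  have hM : 0 ≤ 3 * κ ^ 2 * ((K₂ + 2 * C₁ * K + C₂ * Cu) / R ^ 3) ^ 2 := by positivity
  have hind0 : 0 ≤ (closedBall (0 : EuclideanSpace ℝ (Fin 3)) (4 * R)).indicator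
      (fun _ => 3 * κ ^ 2 * ((K₂ + 2 * C₁ * K + C₂ * Cu) / R ^ 3) ^ 2) y :=
    Set.indicator_nonneg (fun _ _ => hM) _
  have hχ2 : 0 ≤ χ y ^ 2 * frobeniusNormSq (fderiv ℝ (curl U) y) :=
    mul_nonneg (sq_nonneg _) (frobeniusNormSq_nonneg _)
  -- `‖D(curl W)‖ ≤ κ ‖D²W‖`
  have hDcurl : ∀ {W : EuclideanSpace ℝ (Fin 3) → EuclideanSpace ℝ (Fin 3)}, ContDiff ℝ 2 W →
      ∀ z, frobeniusNormSq (fderiv ℝ (curl W) z) ≤ 3 * κ ^ 2 * ‖iteratedFDeriv ℝ 2 W z‖ ^ 2 := by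
    intro W hW z
    refine (frobeniusNormSq_le_three_mul_sq_opNorm _).trans ?_
    rw [fderiv_curl hW z, mul_assoc]
    refine mul_le_mul_of_nonneg_left ?_ (by norm_num)
    calc ‖curlCLM.comp (fderiv ℝ (fderiv ℝ W) z)‖ ^ 2 ≤ (κ * ‖fderiv ℝ (fderiv ℝ W) z‖) ^ 2 :=
          pow_le_pow_left₀ (norm_nonneg _) (ContinuousLinearMap.opNorm_comp_le _ _) 2
      _ = κ ^ 2 * ‖iteratedFDeriv ℝ 2 W z‖ ^ 2 := by
          rw [norm_iteratedFDeriv_two_eq_norm_fderiv_fderiv_fin3]; ring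
  rcases lt_or_ge ‖y‖ (2 * R) with hy2 | hy2
  · have hVU := sliceV_eventuallyEq hχb1 hR0 hχS hV hy2
    have hcurl : curl V =ᶠ[𝓝 y] curl U := by
      filter_upwards [hVU.fderiv (𝕜 := ℝ)] with z hz
      rw [curl_eq_curlCLM, curl_eq_curlCLM, hz]
    rw [hcurl.fderiv_eq]
    rcases lt_or_ge ‖y‖ R with hy1 | hy1
    · have hχ1 : χ y = 1 := by rw [hχ]; exact cutoffScale_eq_one hχb1 hR0 hy1.le
      rw [hχ1, one_pow, one_mul]
      linarith
    · have hyin : y ∈ closedBall (0 : EuclideanSpace ℝ (Fin 3)) (4 * R) :=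
        mem_closedBall_zero_iff.2 (by linarith)
      rw [Set.indicator_of_mem hyin]
      have hb : frobeniusNormSq (fderiv ℝ (curl U) y) ≤
          3 * κ ^ 2 * ((K₂ + 2 * C₁ * K + C₂ * Cu) / R ^ 3) ^ 2 := by
        refine (hDcurl hU2 y).trans ?_
        have hKR : ‖iteratedFDeriv ℝ 2 U y‖ ≤ (K₂ + 2 * C₁ * K + C₂ * Cu) / R ^ 3 :=
          ((h2 y (by linarith)).trans (typeI_bound_le_of_le hK₂ hR0 (by linarith) 3)).trans
            (div_le_div_of_nonneg_right (by nlinarith) (by positivity))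
        exact mul_le_mul_of_nonneg_left (pow_le_pow_left₀ (norm_nonneg _) hKR 2) (by positivity)
      linarith
  · rcases le_or_gt ‖y‖ (4 * R) with hy4 | hy4
    · have hyin : y ∈ closedBall (0 : EuclideanSpace ℝ (Fin 3)) (4 * R) :=
        mem_closedBall_zero_iff.2 hy4
      rw [Set.indicator_of_mem hyin]
      have hD2V := (sliceV_norm_fderiv_le_annulus hχb hχb01 hC₁0 hC₂0 hC₁ hC₂ hR hU hCu hK hK₂ h0
        h1 h2 hχS hV hy2 hy4).2
      have hb : frobeniusNormSq (fderiv ℝ (curl V) y) ≤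
          3 * κ ^ 2 * ((K₂ + 2 * C₁ * K + C₂ * Cu) / R ^ 3) ^ 2 := by
        refine (hDcurl hV2 y).trans ?_
        exact mul_le_mul_of_nonneg_left (pow_le_pow_left₀ (norm_nonneg _) hD2V 2) (by positivity)
      linarith
    · have h0' := (sliceV_fderiv_eq_zero hχb0 hR0 hχS hV hy4).2.1
      rw [h0', frobeniusNormSq_zero]
      linarith

/-- **Majorant of `|D(div V)|²`**: `‖D(div V)‖² ≤ M 𝟙_{B̄(0,4R)}`,
`M = τ²(K₂ + 2C₁K + C₂C_u)²/R⁶` (`div V = 0` on `B(0, 2R)`). [folklore] -/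
theorem sq_norm_fderiv_divergence_sliceV_le (hχb : ContDiff ℝ 3 χb)
    (hχb1 : ∀ x, ‖x‖ ≤ 1 → χb x = 1)
    (hχb0 : ∀ x, 2 ≤ ‖x‖ → χb x = 0) (hχb01 : ∀ x, |χb x| ≤ 1) (hC₁0 : 0 ≤ C₁) (hC₂0 : 0 ≤ C₂)
    (hC₁ : ∀ x, ‖fderiv ℝ χb x‖ ≤ C₁) (hC₂ : ∀ x, ‖iteratedFDeriv ℝ 2 χb x‖ ≤ C₂) (hR : 1 ≤ R)
    (hU : ContDiff ℝ 3 U)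
    (hdiv : ∀ y : EuclideanSpace ℝ (Fin 3), ‖y‖ < 5 * R → VectorCalculus.divergence U y = 0)
    (hCu : 0 ≤ Cu) (hK : 0 ≤ K) (hK₂ : 0 ≤ K₂)
    (h0 : ∀ y : EuclideanSpace ℝ (Fin 3), ‖y‖ ≤ 4 * R → ‖U y‖ ≤ Cu / (1 + ‖y‖))
    (h1 : ∀ y : EuclideanSpace ℝ (Fin 3), ‖y‖ ≤ 4 * R → ‖fderiv ℝ U y‖ ≤ K / (1 + ‖y‖) ^ 2)
    (h2 : ∀ y : EuclideanSpace ℝ (Fin 3), ‖y‖ ≤ 4 * R →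
      ‖iteratedFDeriv ℝ 2 U y‖ ≤ K₂ / (1 + ‖y‖) ^ 3)
    (hχS : χS = fun y => χb ((2 * R)⁻¹ • y)) (hV : V = fun y => χS y • U y)
    (y : EuclideanSpace ℝ (Fin 3)) :
    ‖fderiv ℝ (VectorCalculus.divergence V) y‖ ^ 2 ≤
      (closedBall (0 : EuclideanSpace ℝ (Fin 3)) (4 * R)).indicator
        (fun _ => ‖(traceCLM : (EuclideanSpace ℝ (Fin 3) →L[ℝ] EuclideanSpace ℝ (Fin 3)) →L[ℝ] ℝ)‖ ^ 2 *
          ((K₂ + 2 * C₁ * K + C₂ * Cu) / R ^ 3) ^ 2) y := by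
  have hR0 : 0 < R := by linarith
  set τ : ℝ := ‖(traceCLM : (EuclideanSpace ℝ (Fin 3) →L[ℝ] EuclideanSpace ℝ (Fin 3)) →L[ℝ] ℝ)‖
    with hτ
  have hV2 : ContDiff ℝ 2 V := (sliceV_contDiff hχb hU hχS hV).of_le (by norm_num)
  have hM : 0 ≤ τ ^ 2 * ((K₂ + 2 * C₁ * K + C₂ * Cu) / R ^ 3) ^ 2 := by positivity
  have hind0 : 0 ≤ (closedBall (0 : EuclideanSpace ℝ (Fin 3)) (4 * R)).indicator
      (fun _ => τ ^ 2 * ((K₂ + 2 * C₁ * K + C₂ * Cu) / R ^ 3) ^ 2) y :=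
    Set.indicator_nonneg (fun _ _ => hM) _
  rcases lt_or_ge ‖y‖ (2 * R) with hy2 | hy2
  · -- `div V = 0` near `y`
    have hVU := sliceV_eventuallyEq hχb1 hR0 hχS hV hy2
    have hnear : ∀ᶠ z in 𝓝 y, ‖z‖ < 2 * R :=
      Filter.eventually_of_mem (isOpen_ball.mem_nhds (mem_ball_zero_iff.2 hy2))
        fun z hz => mem_ball_zero_iff.1 hz
    have hd : VectorCalculus.divergence V =ᶠ[𝓝 y] fun _ => (0 : ℝ) := by
      filter_upwards [hVU.fderiv (𝕜 := ℝ), hnear] with z hz hz2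
      rw [divergence_eq_traceCLM, hz, ← divergence_eq_traceCLM]
      exact hdiv z (by linarith)
    rw [hd.fderiv_eq, fderiv_const_apply, norm_zero, zero_pow two_ne_zero]
    exact hind0
  · rcases le_or_gt ‖y‖ (4 * R) with hy4 | hy4
    · have hyin : y ∈ closedBall (0 : EuclideanSpace ℝ (Fin 3)) (4 * R) :=
        mem_closedBall_zero_iff.2 hy4
      rw [Set.indicator_of_mem hyin]
      have hD2V := (sliceV_norm_fderiv_le_annulus hχb hχb01 hC₁0 hC₂0 hC₁ hC₂ hR hU hCu hK hK₂ h0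
        h1 h2 hχS hV hy2 hy4).2
      rw [fderiv_divergence_eq hV2]
      calc ‖(traceCLM : (EuclideanSpace ℝ (Fin 3) →L[ℝ] EuclideanSpace ℝ (Fin 3)) →L[ℝ] ℝ).comp
            (fderiv ℝ (fderiv ℝ V) y)‖ ^ 2 ≤ (τ * ‖fderiv ℝ (fderiv ℝ V) y‖) ^ 2 :=
            pow_le_pow_left₀ (norm_nonneg _) (ContinuousLinearMap.opNorm_comp_le _ _) 2
        _ ≤ (τ * ((K₂ + 2 * C₁ * K + C₂ * Cu) / R ^ 3)) ^ 2 := by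
            rw [← norm_iteratedFDeriv_two_eq_norm_fderiv_fderiv_fin3]
            exact pow_le_pow_left₀ (mul_nonneg (norm_nonneg _) (norm_nonneg _))
              (mul_le_mul_of_nonneg_left hD2V (norm_nonneg _)) 2
        _ = τ ^ 2 * ((K₂ + 2 * C₁ * K + C₂ * Cu) / R ^ 3) ^ 2 := by ring
    · have h0' := (sliceV_fderiv_eq_zero hχb0 hR0 hχS hV hy4).2.2
      rw [h0', norm_zero, zero_pow two_ne_zero]
      exact hind0

/-- **Majorant of `|D(χ Ω)|²`**, `Ω = curl U`, `χ = χ̄(·/R)`: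
`‖D(χΩ)‖² ≤ 2χ²|DΩ|²_F + M 𝟙_{B̄(0,4R)}`, `M = 2C₁²κ²K²/R⁶`. [folklore] -/
theorem sq_norm_fderiv_smul_curl_le (hχb : ContDiff ℝ 3 χb)
    (hχb1 : ∀ x, ‖x‖ ≤ 1 → χb x = 1)
    (hχb0 : ∀ x, 2 ≤ ‖x‖ → χb x = 0)
    (hC₁ : ∀ x, ‖fderiv ℝ χb x‖ ≤ C₁) (hR : 1 ≤ R)
    (hU : ContDiff ℝ 3 U) (hK : 0 ≤ K)
    (h1 : ∀ y : EuclideanSpace ℝ (Fin 3), ‖y‖ ≤ 4 * R → ‖fderiv ℝ U y‖ ≤ K / (1 + ‖y‖) ^ 2)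
    (hχ : χ = fun y => χb (R⁻¹ • y)) (y : EuclideanSpace ℝ (Fin 3)) :
    ‖fderiv ℝ (fun z => χ z • curl U z) y‖ ^ 2 ≤
      2 * (χ y ^ 2 * frobeniusNormSq (fderiv ℝ (curl U) y)) +
      (closedBall (0 : EuclideanSpace ℝ (Fin 3)) (4 * R)).indicator
        (fun _ => 2 * (C₁ / R) ^ 2 * (‖curlCLM‖ ^ 2 * (K / R ^ 2) ^ 2)) y := by
  have hR0 : 0 < R := by linarith
  set κ : ℝ := ‖curlCLM‖ with hκ
  have hχd : ContDiff ℝ 3 χ := by rw [hχ]; exact hχb.comp (contDiff_const_smul _)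
  have hΩ : ContDiff ℝ 2 (curl U) := contDiff_curl (n := 2) (by exact_mod_cast hU)
  have hM : 0 ≤ 2 * (C₁ / R) ^ 2 * (κ ^ 2 * (K / R ^ 2) ^ 2) := by positivity
  have hind0 : 0 ≤ (closedBall (0 : EuclideanSpace ℝ (Fin 3)) (4 * R)).indicator
      (fun _ => 2 * (C₁ / R) ^ 2 * (κ ^ 2 * (K / R ^ 2) ^ 2)) y :=
    Set.indicator_nonneg (fun _ _ => hM) _
  -- Leibniz
  have hL := norm_fderiv_smul_le_fin3 (hχd.differentiable (by norm_num) y) (hΩ.differentiable (by norm_num) y)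
  have hsq : ‖fderiv ℝ (fun z => χ z • curl U z) y‖ ^ 2 ≤
      2 * (χ y ^ 2 * ‖fderiv ℝ (curl U) y‖ ^ 2) + 2 * (‖fderiv ℝ χ y‖ ^ 2 * ‖curl U y‖ ^ 2) := by
    calc ‖fderiv ℝ (fun z => χ z • curl U z) y‖ ^ 2
        ≤ (|χ y| * ‖fderiv ℝ (curl U) y‖ + ‖fderiv ℝ χ y‖ * ‖curl U y‖) ^ 2 :=
          pow_le_pow_left₀ (norm_nonneg _) hL 2
      _ ≤ 2 * (|χ y| * ‖fderiv ℝ (curl U) y‖) ^ 2 + 2 * (‖fderiv ℝ χ y‖ * ‖curl U y‖) ^ 2 :=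
          by nlinarith [sq_nonneg (|χ y| * ‖fderiv ℝ (curl U) y‖ - ‖fderiv ℝ χ y‖ * ‖curl U y‖)]
      _ = 2 * (χ y ^ 2 * ‖fderiv ℝ (curl U) y‖ ^ 2) + 2 * (‖fderiv ℝ χ y‖ ^ 2 * ‖curl U y‖ ^ 2) := by
          rw [mul_pow, mul_pow, sq_abs]
  have hop : ‖fderiv ℝ (curl U) y‖ ^ 2 ≤ frobeniusNormSq (fderiv ℝ (curl U) y) :=
    sq_opNorm_le_frobeniusNormSq _
  have hfirst : 2 * (χ y ^ 2 * ‖fderiv ℝ (curl U) y‖ ^ 2) ≤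
      2 * (χ y ^ 2 * frobeniusNormSq (fderiv ℝ (curl U) y)) := by gcongr
  -- the second term
  have hsecond : 2 * (‖fderiv ℝ χ y‖ ^ 2 * ‖curl U y‖ ^ 2) ≤
      (closedBall (0 : EuclideanSpace ℝ (Fin 3)) (4 * R)).indicator
        (fun _ => 2 * (C₁ / R) ^ 2 * (κ ^ 2 * (K / R ^ 2) ^ 2)) y := by
    rcases lt_or_ge ‖y‖ R with hy1 | hy1
    · have h1' : χ =ᶠ[𝓝 y] fun _ => (1 : ℝ) := by
        rw [hχ]; exact cutoffScale_eventuallyEq_one hχb1 hR0 hy1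
      rw [h1'.fderiv_eq, fderiv_const_apply, norm_zero, zero_pow two_ne_zero, zero_mul, mul_zero]
      exact hind0
    · rcases le_or_gt ‖y‖ (2 * R) with hy2 | hy2
      · have hyin : y ∈ closedBall (0 : EuclideanSpace ℝ (Fin 3)) (4 * R) :=
          mem_closedBall_zero_iff.2 (by linarith)
        rw [Set.indicator_of_mem hyin]
        have hDχ : ‖fderiv ℝ χ y‖ ≤ C₁ / R := by
          rw [hχ]; exact norm_fderiv_cutoffScale_le (hχb.of_le (by norm_num)) hC₁ hR0 y
        have hΩb : ‖curl U y‖ ≤ κ * (K / R ^ 2) :=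
          (norm_curl_le _ _).trans (mul_le_mul_of_nonneg_left
            ((h1 y (by linarith)).trans (typeI_bound_le_of_le hK hR0 (by linarith) 2)) (norm_nonneg _))
        calc 2 * (‖fderiv ℝ χ y‖ ^ 2 * ‖curl U y‖ ^ 2)
            ≤ 2 * ((C₁ / R) ^ 2 * (κ * (K / R ^ 2)) ^ 2) := by gcongr
          _ = 2 * (C₁ / R) ^ 2 * (κ ^ 2 * (K / R ^ 2) ^ 2) := by ring
      · have h0' : χ =ᶠ[𝓝 y] fun _ => (0 : ℝ) := by
          rw [hχ]; exact cutoffScale_eventuallyEq_zero hχb0 hR0 hy2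
        rw [h0'.fderiv_eq, fderiv_const_apply, norm_zero, zero_pow two_ne_zero, zero_mul, mul_zero]
        exact hind0
  linarith

end SliceMajorants2


section SliceIntegrals

-- nested operator types
set_option maxSynthPendingDepth 3

variable {χb : EuclideanSpace ℝ (Fin 3) → ℝ} {U V : EuclideanSpace ℝ (Fin 3) → EuclideanSpace ℝ (Fin 3)}
  {χS χ : EuclideanSpace ℝ (Fin 3) → ℝ} {R C₁ C₂ Cu K K₂ : ℝ}

/-- `∫ M 𝟙_{B̄(0,ρ)} = M · vol(B̄(0,ρ))`. [folklore] -/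
theorem integral_indicator_closedBall_const (M ρ : ℝ) :
    ∫ y, (closedBall (0 : EuclideanSpace ℝ (Fin 3)) ρ).indicator (fun _ => M) y =
      M * (volume (closedBall (0 : EuclideanSpace ℝ (Fin 3)) ρ)).toReal := by
  rw [integral_indicator measurableSet_closedBall, setIntegral_const, smul_eq_mul, measureReal_def,
    mul_comm]

/-- The indicator majorants are integrable. [folklore] -/
theorem integrable_indicator_closedBall_const_fin3 (M ρ : ℝ) :
    Integrable ((closedBall (0 : EuclideanSpace ℝ (Fin 3)) ρ).indicator fun _ => M) := by
  refine IntegrableOn.integrable_indicator ?_ measurableSet_closedBall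
  exact (integrableOn_const_iff (C := M)).2 (Or.inr measure_closedBall_lt_top)

/-- The scaled cut-off `χ̄(·/ρ)` has compact support. [folklore] -/
theorem hasCompactSupport_cutoffScale (hχb0 : ∀ x, 2 ≤ ‖x‖ → χb x = 0) {ρ : ℝ} (hρ : 0 < ρ) :
    HasCompactSupport fun z : EuclideanSpace ℝ (Fin 3) => χb (ρ⁻¹ • z) := by
  refine HasCompactSupport.intro (isCompact_closedBall (0 : EuclideanSpace ℝ (Fin 3)) (2 * ρ))
    fun y hy => ?_
  rw [mem_closedBall_zero_iff, not_le] at hy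
  exact cutoffScale_eq_zero hχb0 hρ hy.le

/-- A weighted square `χ² g` with `χ` compactly supported continuous and `g` continuous is
integrable. [folklore] -/
theorem integrable_cutoff_sq_mul {g : EuclideanSpace ℝ (Fin 3) → ℝ} (hχc : HasCompactSupport χ)
    (hχ : Continuous χ) (hg : Continuous g) : Integrable fun y => χ y ^ 2 * g y := by
  have hc : HasCompactSupport fun y => χ y ^ 2 * g y :=
    (hχc.comp_left (g := fun t : ℝ => t ^ 2) (by simp)).mul_right
  exact ((hχ.pow 2).mul hg).integrable_of_hasCompactSupport hc

/-- Continuity of `y ↦ |DW(y)|²_F` for `W ∈ C¹`. [folklore] -/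
theorem continuous_frobeniusNormSq_fderiv_of_contDiff {F : Type*} [NormedAddCommGroup F]
    [InnerProductSpace ℝ F] [FiniteDimensional ℝ F] {W : EuclideanSpace ℝ (Fin 3) → F}
    (hW : ContDiff ℝ 1 W) : Continuous fun y => frobeniusNormSq (fderiv ℝ W y) := by
  unfold frobeniusNormSq
  exact continuous_finsetSum _ fun i _ =>
    (((hW.continuous_fderiv one_ne_zero).clm_apply continuous_const).norm).pow 2

/-- **`Σ`-free bound of `‖∂ₖV‖²_{L²}` by `F² + O(R⁻¹)`**:
`∫ ‖DV eₖ‖² ≤ ∫ |DV|²_F = ∫ |curl V|² + ∫ (div V)² ≤ F² + (M_c + M_d) vol(B̄(0,4R))`,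
`F² = ∫ χ² |curl U|²`. [folklore] -/
theorem integral_sq_norm_fderiv_apply_sliceV_le (hχb : ContDiff ℝ 3 χb)
    (hχb1 : ∀ x, ‖x‖ ≤ 1 → χb x = 1)
    (hχb0 : ∀ x, 2 ≤ ‖x‖ → χb x = 0) (hχb01 : ∀ x, |χb x| ≤ 1) (hC₁0 : 0 ≤ C₁) (hC₂0 : 0 ≤ C₂)
    (hC₁ : ∀ x, ‖fderiv ℝ χb x‖ ≤ C₁) (hC₂ : ∀ x, ‖iteratedFDeriv ℝ 2 χb x‖ ≤ C₂) (hR : 1 ≤ R)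
    (hU : ContDiff ℝ 3 U)
    (hdiv : ∀ y : EuclideanSpace ℝ (Fin 3), ‖y‖ < 5 * R → VectorCalculus.divergence U y = 0)
    (hCu : 0 ≤ Cu) (hK : 0 ≤ K) (hK₂ : 0 ≤ K₂)
    (h0 : ∀ y : EuclideanSpace ℝ (Fin 3), ‖y‖ ≤ 4 * R → ‖U y‖ ≤ Cu / (1 + ‖y‖))
    (h1 : ∀ y : EuclideanSpace ℝ (Fin 3), ‖y‖ ≤ 4 * R → ‖fderiv ℝ U y‖ ≤ K / (1 + ‖y‖) ^ 2)
    (h2 : ∀ y : EuclideanSpace ℝ (Fin 3), ‖y‖ ≤ 4 * R →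
      ‖iteratedFDeriv ℝ 2 U y‖ ≤ K₂ / (1 + ‖y‖) ^ 3)
    (hχS : χS = fun y => χb ((2 * R)⁻¹ • y)) (hχ : χ = fun y => χb (R⁻¹ • y))
    (hV : V = fun y => χS y • U y) (k : Fin 3) :
    ∫ y, ‖fderiv ℝ V y (EuclideanSpace.basisFun (Fin 3) ℝ k)‖ ^ 2 ≤
      (∫ y, χ y ^ 2 * ‖curl U y‖ ^ 2) +
        (‖curlCLM‖ ^ 2 * ((K + C₁ * Cu) / R ^ 2) ^ 2 +
          ‖(traceCLM : (EuclideanSpace ℝ (Fin 3) →L[ℝ] EuclideanSpace ℝ (Fin 3)) →L[ℝ] ℝ)‖ ^ 2 *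
            ((K + C₁ * Cu) / R ^ 2) ^ 2) *
          (volume (closedBall (0 : EuclideanSpace ℝ (Fin 3)) (4 * R))).toReal := by
  have hR0 : 0 < R := by linarith
  obtain ⟨vol, hvol⟩ : ∃ vol : ℝ, (volume (closedBall (0 : EuclideanSpace ℝ (Fin 3)) (4 * R))).toReal = vol :=
    ⟨_, rfl⟩
  obtain ⟨Mc, hMc⟩ : ∃ M : ℝ, ‖curlCLM‖ ^ 2 * ((K + C₁ * Cu) / R ^ 2) ^ 2 = M := ⟨_, rfl⟩
  obtain ⟨Md, hMd⟩ : ∃ M : ℝ,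
      ‖(traceCLM : (EuclideanSpace ℝ (Fin 3) →L[ℝ] EuclideanSpace ℝ (Fin 3)) →L[ℝ] ℝ)‖ ^ 2 *
        ((K + C₁ * Cu) / R ^ 2) ^ 2 = M := ⟨_, rfl⟩
  rw [hvol, hMc, hMd]
  have hV3 : ContDiff ℝ 3 V := sliceV_contDiff hχb hU hχS hV
  have hV2 : ContDiff ℝ 2 V := hV3.of_le (by norm_num)
  have hV1 : ContDiff ℝ 1 V := hV3.of_le (by norm_num)
  have hVc : HasCompactSupport V := sliceV_hasCompactSupport hχb0 hR0 hχS hV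
  have hχc : HasCompactSupport χ := by rw [hχ]; exact hasCompactSupport_cutoffScale hχb0 hR0
  have hχcont : Continuous χ := by
    rw [hχ]; exact (hχb.continuous).comp (continuous_const_smul _)
  have hU1 : ContDiff ℝ 1 U := hU.of_le (by norm_num)
  -- integrability
  have hDVc : Continuous fun y => fderiv ℝ V y := hV1.continuous_fderiv one_ne_zero
  have hDVs : HasCompactSupport fun y => fderiv ℝ V y := hVc.fderiv ℝ
  have cL : Continuous fun y => ‖fderiv ℝ V y (EuclideanSpace.basisFun (Fin 3) ℝ k)‖ ^ 2 :=
    (hDVc.clm_apply continuous_const).norm.pow 2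
  have sL0 : HasCompactSupport fun y => fderiv ℝ V y (EuclideanSpace.basisFun (Fin 3) ℝ k) :=
    hVc.fderiv_apply ℝ (EuclideanSpace.basisFun (Fin 3) ℝ k)
  have sL : HasCompactSupport fun y => ‖fderiv ℝ V y (EuclideanSpace.basisFun (Fin 3) ℝ k)‖ ^ 2 :=
    sL0.norm.comp_left (g := fun t : ℝ => t ^ 2) (by simp)
  have iL : Integrable fun y => ‖fderiv ℝ V y (EuclideanSpace.basisFun (Fin 3) ℝ k)‖ ^ 2 :=
    cL.integrable_of_hasCompactSupport sL
  have cF : Continuous fun y => frobeniusNormSq (fderiv ℝ V y) :=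
    continuous_frobeniusNormSq_fderiv_of_contDiff hV1
  have sF : HasCompactSupport fun y => frobeniusNormSq (fderiv ℝ V y) :=
    hDVs.comp_left frobeniusNormSq_zero
  have iF : Integrable fun y => frobeniusNormSq (fderiv ℝ V y) := cF.integrable_of_hasCompactSupport sF
  have ccurl : Continuous fun y => ‖curl V y‖ ^ 2 := (continuous_curl hV1).norm.pow 2
  have scurl0 : HasCompactSupport (curl V) := hasCompactSupport_curl hVc
  have scurl : HasCompactSupport fun y => ‖curl V y‖ ^ 2 :=
    scurl0.norm.comp_left (g := fun t : ℝ => t ^ 2) (by simp)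
  have icurl : Integrable fun y => ‖curl V y‖ ^ 2 := ccurl.integrable_of_hasCompactSupport scurl
  have cdiv : Continuous fun y => VectorCalculus.divergence V y := by
    rw [divergence_eq_traceCLM_comp]; exact traceCLM.continuous.comp hDVc
  have sdiv0 : HasCompactSupport fun y => VectorCalculus.divergence V y := by
    rw [divergence_eq_traceCLM_comp]; exact hDVs.comp_left (map_zero _)
  have sdiv : HasCompactSupport fun y => VectorCalculus.divergence V y ^ 2 :=
    sdiv0.comp_left (g := fun t : ℝ => t ^ 2) (by simp)
  have idiv : Integrable fun y => VectorCalculus.divergence V y ^ 2 :=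
    (cdiv.pow 2).integrable_of_hasCompactSupport sdiv
  have iFχ : Integrable fun y => χ y ^ 2 * ‖curl U y‖ ^ 2 :=
    integrable_cutoff_sq_mul hχc hχcont ((continuous_curl hU1).norm.pow 2)
  -- the chain
  have s1 : ∫ y, ‖fderiv ℝ V y (EuclideanSpace.basisFun (Fin 3) ℝ k)‖ ^ 2 ≤
      ∫ y, frobeniusNormSq (fderiv ℝ V y) :=
    integral_mono iL iF fun y => sq_norm_apply_basisFun_le_frobeniusNormSq _ k
  have s2 := integral_frobeniusNormSq_fderiv_eq_of_hasCompactSupport hV2 hVc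
  have s3 : ∫ y, ‖curl V y‖ ^ 2 ≤ (∫ y, χ y ^ 2 * ‖curl U y‖ ^ 2) + Mc * vol := by
    have h := integral_le_of_le_add_indicator icurl iFχ
      (sq_norm_curl_sliceV_le hχb hχb1 hχb0 hχb01 hC₁0 hC₂0 hC₁ hC₂ hR hU hCu hK hK₂ h0 h1 h2 hχS
        hχ hV)
    rwa [hMc, hvol] at h
  have s4 : ∫ y, VectorCalculus.divergence V y ^ 2 ≤ Md * vol := by
    have h := integral_mono idiv (integrable_indicator_closedBall_const_fin3 _ _)
      (sq_divergence_sliceV_le hχb hχb1 hχb0 hχb01 hC₁0 hC₂0 hC₁ hC₂ hR hU hdiv hCu hK hK₂ h0 h1 h2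
        hχS hV)
    rwa [integral_indicator_closedBall_const, hMd, hvol] at h
  calc ∫ y, ‖fderiv ℝ V y (EuclideanSpace.basisFun (Fin 3) ℝ k)‖ ^ 2
      ≤ ∫ y, frobeniusNormSq (fderiv ℝ V y) := s1
    _ = (∫ y, ‖curl V y‖ ^ 2) + ∫ y, VectorCalculus.divergence V y ^ 2 := s2
    _ ≤ ((∫ y, χ y ^ 2 * ‖curl U y‖ ^ 2) + Mc * vol) + Md * vol := add_le_add s3 s4
    _ = (∫ y, χ y ^ 2 * ‖curl U y‖ ^ 2) + (Mc + Md) * vol := by ring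

/-- **Bound of `‖D(∂ₖV)‖²_{L²}` by `D² + O(R⁻³)`**:
`∫ ‖D(DV eₖ)‖² ≤ ∫ |D(DVeₖ)|²_F = ∫ |curl ∂ₖV|² + ∫ (div ∂ₖV)² = ∫ |∂ₖ curl V|² + ∫ (∂ₖ div V)²`
`≤ D² + (M + M') vol(B̄(0,4R))`, `D² = ∫ χ² |D(curl U)|²_F`. [folklore] -/
theorem integral_sq_norm_fderiv_fderiv_apply_sliceV_le (hχb : ContDiff ℝ 3 χb)
    (hχb1 : ∀ x, ‖x‖ ≤ 1 → χb x = 1)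
    (hχb0 : ∀ x, 2 ≤ ‖x‖ → χb x = 0) (hχb01 : ∀ x, |χb x| ≤ 1) (hC₁0 : 0 ≤ C₁) (hC₂0 : 0 ≤ C₂)
    (hC₁ : ∀ x, ‖fderiv ℝ χb x‖ ≤ C₁) (hC₂ : ∀ x, ‖iteratedFDeriv ℝ 2 χb x‖ ≤ C₂) (hR : 1 ≤ R)
    (hU : ContDiff ℝ 3 U)
    (hdiv : ∀ y : EuclideanSpace ℝ (Fin 3), ‖y‖ < 5 * R → VectorCalculus.divergence U y = 0)
    (hCu : 0 ≤ Cu) (hK : 0 ≤ K) (hK₂ : 0 ≤ K₂)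
    (h0 : ∀ y : EuclideanSpace ℝ (Fin 3), ‖y‖ ≤ 4 * R → ‖U y‖ ≤ Cu / (1 + ‖y‖))
    (h1 : ∀ y : EuclideanSpace ℝ (Fin 3), ‖y‖ ≤ 4 * R → ‖fderiv ℝ U y‖ ≤ K / (1 + ‖y‖) ^ 2)
    (h2 : ∀ y : EuclideanSpace ℝ (Fin 3), ‖y‖ ≤ 4 * R →
      ‖iteratedFDeriv ℝ 2 U y‖ ≤ K₂ / (1 + ‖y‖) ^ 3)
    (hχS : χS = fun y => χb ((2 * R)⁻¹ • y)) (hχ : χ = fun y => χb (R⁻¹ • y))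
    (hV : V = fun y => χS y • U y) (k : Fin 3) :
    ∫ y, ‖fderiv ℝ (fun z => fderiv ℝ V z (EuclideanSpace.basisFun (Fin 3) ℝ k)) y‖ ^ 2 ≤
      (∫ y, χ y ^ 2 * frobeniusNormSq (fderiv ℝ (curl U) y)) +
        (3 * ‖curlCLM‖ ^ 2 * ((K₂ + 2 * C₁ * K + C₂ * Cu) / R ^ 3) ^ 2 +
          ‖(traceCLM : (EuclideanSpace ℝ (Fin 3) →L[ℝ] EuclideanSpace ℝ (Fin 3)) →L[ℝ] ℝ)‖ ^ 2 *
            ((K₂ + 2 * C₁ * K + C₂ * Cu) / R ^ 3) ^ 2) *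
          (volume (closedBall (0 : EuclideanSpace ℝ (Fin 3)) (4 * R))).toReal := by
  have hR0 : 0 < R := by linarith
  obtain ⟨e, he⟩ : ∃ e : EuclideanSpace ℝ (Fin 3), EuclideanSpace.basisFun (Fin 3) ℝ k = e := ⟨_, rfl⟩
  obtain ⟨vol, hvol⟩ : ∃ vol : ℝ, (volume (closedBall (0 : EuclideanSpace ℝ (Fin 3)) (4 * R))).toReal = vol :=
    ⟨_, rfl⟩
  obtain ⟨M₁, hM₁⟩ : ∃ M : ℝ, 3 * ‖curlCLM‖ ^ 2 * ((K₂ + 2 * C₁ * K + C₂ * Cu) / R ^ 3) ^ 2 = M :=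
    ⟨_, rfl⟩
  obtain ⟨M₂, hM₂⟩ : ∃ M : ℝ,
      ‖(traceCLM : (EuclideanSpace ℝ (Fin 3) →L[ℝ] EuclideanSpace ℝ (Fin 3)) →L[ℝ] ℝ)‖ ^ 2 *
        ((K₂ + 2 * C₁ * K + C₂ * Cu) / R ^ 3) ^ 2 = M := ⟨_, rfl⟩
  rw [he, hvol, hM₁, hM₂]
  have hV3 : ContDiff ℝ 3 V := sliceV_contDiff hχb hU hχS hV
  have hV2 : ContDiff ℝ 2 V := hV3.of_le (by norm_num)
  have hVc : HasCompactSupport V := sliceV_hasCompactSupport hχb0 hR0 hχS hV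
  have hχc : HasCompactSupport χ := by rw [hχ]; exact hasCompactSupport_cutoffScale hχb0 hR0
  have hχcont : Continuous χ := by
    rw [hχ]; exact (hχb.continuous).comp (continuous_const_smul _)
  have hU2 : ContDiff ℝ 2 U := hU.of_le (by norm_num)
  -- the field `W = ∂ₖV`
  obtain ⟨W, hW⟩ : ∃ W : EuclideanSpace ℝ (Fin 3) → EuclideanSpace ℝ (Fin 3),
      (fun z => fderiv ℝ V z e) = W := ⟨_, rfl⟩
  rw [hW]
  have hW2 : ContDiff ℝ 2 W := by
    rw [← hW]; exact (hV3.fderiv_right (m := 2) le_rfl).clm_apply contDiff_const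
  have hW1 : ContDiff ℝ 1 W := hW2.of_le (by norm_num)
  have hWc : HasCompactSupport W := by rw [← hW]; exact hVc.fderiv_apply ℝ e
  -- integrability
  have hDWc : Continuous fun y => fderiv ℝ W y := hW1.continuous_fderiv one_ne_zero
  have hDWs : HasCompactSupport fun y => fderiv ℝ W y := hWc.fderiv ℝ
  have cL : Continuous fun y => ‖fderiv ℝ W y‖ ^ 2 := hDWc.norm.pow 2
  have sL : HasCompactSupport fun y => ‖fderiv ℝ W y‖ ^ 2 :=
    hDWs.norm.comp_left (g := fun t : ℝ => t ^ 2) (by simp)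
  have iL : Integrable fun y => ‖fderiv ℝ W y‖ ^ 2 := cL.integrable_of_hasCompactSupport sL
  have cF : Continuous fun y => frobeniusNormSq (fderiv ℝ W y) :=
    continuous_frobeniusNormSq_fderiv_of_contDiff hW1
  have sF : HasCompactSupport fun y => frobeniusNormSq (fderiv ℝ W y) :=
    hDWs.comp_left frobeniusNormSq_zero
  have iF : Integrable fun y => frobeniusNormSq (fderiv ℝ W y) := cF.integrable_of_hasCompactSupport sF
  have ccurl : Continuous fun y => ‖curl W y‖ ^ 2 := (continuous_curl hW1).norm.pow 2
  have scurl0 : HasCompactSupport (curl W) := hasCompactSupport_curl hWc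
  have scurl : HasCompactSupport fun y => ‖curl W y‖ ^ 2 :=
    scurl0.norm.comp_left (g := fun t : ℝ => t ^ 2) (by simp)
  have icurl : Integrable fun y => ‖curl W y‖ ^ 2 := ccurl.integrable_of_hasCompactSupport scurl
  have cdiv : Continuous fun y => VectorCalculus.divergence W y := by
    rw [divergence_eq_traceCLM_comp]; exact traceCLM.continuous.comp hDWc
  have sdiv0 : HasCompactSupport fun y => VectorCalculus.divergence W y := by
    rw [divergence_eq_traceCLM_comp]; exact hDWs.comp_left (map_zero _)
  have sdiv : HasCompactSupport fun y => VectorCalculus.divergence W y ^ 2 :=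
    sdiv0.comp_left (g := fun t : ℝ => t ^ 2) (by simp)
  have idiv : Integrable fun y => VectorCalculus.divergence W y ^ 2 :=
    (cdiv.pow 2).integrable_of_hasCompactSupport sdiv
  have hcurlU1 : ContDiff ℝ 1 (curl U) := contDiff_curl (n := 1) (by exact_mod_cast hU2)
  have iD : Integrable fun y => χ y ^ 2 * frobeniusNormSq (fderiv ℝ (curl U) y) :=
    integrable_cutoff_sq_mul hχc hχcont (continuous_frobeniusNormSq_fderiv_of_contDiff hcurlU1)
  -- pointwise: `curl W = ∂ₖ curl V`, `div W = ∂ₖ div V`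
  have pc : ∀ y, ‖curl W y‖ ^ 2 ≤ χ y ^ 2 * frobeniusNormSq (fderiv ℝ (curl U) y) +
      (closedBall (0 : EuclideanSpace ℝ (Fin 3)) (4 * R)).indicator (fun _ => M₁) y := by
    intro y
    have hcw : curl W y = fderiv ℝ (curl V) y e := by rw [← hW]; exact curl_fderiv_apply hV2 y e
    have h := frobeniusNormSq_fderiv_curl_sliceV_le hχb hχb1 hχb0 hχb01 hC₁0 hC₂0 hC₁ hC₂ hR hU hCu
      hK hK₂ h0 h1 h2 hχS hχ hV y
    rw [hM₁] at h
    rw [hcw, ← he]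
    exact (sq_norm_apply_basisFun_le_frobeniusNormSq _ k).trans h
  have pd : ∀ y, VectorCalculus.divergence W y ^ 2 ≤
      (closedBall (0 : EuclideanSpace ℝ (Fin 3)) (4 * R)).indicator (fun _ => M₂) y := by
    intro y
    have hdw : VectorCalculus.divergence W y = fderiv ℝ (VectorCalculus.divergence V) y e := by
      rw [← hW]; exact divergence_fderiv_apply hV2 y e
    rw [hdw]
    have h := sq_norm_fderiv_divergence_sliceV_le hχb hχb1 hχb0 hχb01 hC₁0 hC₂0 hC₁ hC₂
      hR hU hdiv hCu hK hK₂ h0 h1 h2 hχS hV y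
    rw [hM₂] at h
    refine le_trans ?_ h
    have he1 : ‖e‖ = 1 := by rw [← he]; exact (EuclideanSpace.basisFun (Fin 3) ℝ).orthonormal.1 k
    calc fderiv ℝ (VectorCalculus.divergence V) y e ^ 2
        ≤ ‖fderiv ℝ (VectorCalculus.divergence V) y e‖ ^ 2 := by rw [Real.norm_eq_abs, sq_abs]
      _ ≤ (‖fderiv ℝ (VectorCalculus.divergence V) y‖ * ‖e‖) ^ 2 :=
          pow_le_pow_left₀ (norm_nonneg _) (ContinuousLinearMap.le_opNorm _ _) 2
      _ = ‖fderiv ℝ (VectorCalculus.divergence V) y‖ ^ 2 := by rw [he1, mul_one]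
  -- the chain
  have s1 : ∫ y, ‖fderiv ℝ W y‖ ^ 2 ≤ ∫ y, frobeniusNormSq (fderiv ℝ W y) :=
    integral_mono iL iF fun y => sq_opNorm_le_frobeniusNormSq _
  have s2 := integral_frobeniusNormSq_fderiv_eq_of_hasCompactSupport hW2 hWc
  have s3 : ∫ y, ‖curl W y‖ ^ 2 ≤
      (∫ y, χ y ^ 2 * frobeniusNormSq (fderiv ℝ (curl U) y)) + M₁ * vol := by
    have h := integral_le_of_le_add_indicator icurl iD pc
    rwa [hvol] at h
  have s4 : ∫ y, VectorCalculus.divergence W y ^ 2 ≤ M₂ * vol := by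
    have h := integral_mono idiv (integrable_indicator_closedBall_const_fin3 _ _) pd
    rwa [integral_indicator_closedBall_const, hvol] at h
  calc ∫ y, ‖fderiv ℝ W y‖ ^ 2 ≤ ∫ y, frobeniusNormSq (fderiv ℝ W y) := s1
    _ = (∫ y, ‖curl W y‖ ^ 2) + ∫ y, VectorCalculus.divergence W y ^ 2 := s2
    _ ≤ ((∫ y, χ y ^ 2 * frobeniusNormSq (fderiv ℝ (curl U) y)) + M₁ * vol) + M₂ * vol :=
        add_le_add s3 s4
    _ = (∫ y, χ y ^ 2 * frobeniusNormSq (fderiv ℝ (curl U) y)) + (M₁ + M₂) * vol := by ring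

/-- **`‖χΩ‖²_{L²} = F²`**. [folklore] -/
theorem integral_sq_norm_smul_curl_eq (χ : EuclideanSpace ℝ (Fin 3) → ℝ)
    (U : EuclideanSpace ℝ (Fin 3) → EuclideanSpace ℝ (Fin 3)) :
    ∫ y, ‖χ y • curl U y‖ ^ 2 = ∫ y, χ y ^ 2 * ‖curl U y‖ ^ 2 :=
  integral_congr_ae (Eventually.of_forall fun y => by
    simp only [norm_smul, Real.norm_eq_abs, mul_pow, sq_abs])

/-- **Bound of `‖D(χΩ)‖²_{L²}` by `2D² + O(R⁻³)`**. [folklore] -/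
theorem integral_sq_norm_fderiv_smul_curl_le (hχb : ContDiff ℝ 3 χb)
    (hχb1 : ∀ x, ‖x‖ ≤ 1 → χb x = 1)
    (hχb0 : ∀ x, 2 ≤ ‖x‖ → χb x = 0)
    (hC₁ : ∀ x, ‖fderiv ℝ χb x‖ ≤ C₁) (hR : 1 ≤ R)
    (hU : ContDiff ℝ 3 U) (hK : 0 ≤ K)
    (h1 : ∀ y : EuclideanSpace ℝ (Fin 3), ‖y‖ ≤ 4 * R → ‖fderiv ℝ U y‖ ≤ K / (1 + ‖y‖) ^ 2)
    (hχ : χ = fun y => χb (R⁻¹ • y)) :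
    ∫ y, ‖fderiv ℝ (fun z => χ z • curl U z) y‖ ^ 2 ≤
      2 * (∫ y, χ y ^ 2 * frobeniusNormSq (fderiv ℝ (curl U) y)) +
        (2 * (C₁ / R) ^ 2 * (‖curlCLM‖ ^ 2 * (K / R ^ 2) ^ 2)) *
          (volume (closedBall (0 : EuclideanSpace ℝ (Fin 3)) (4 * R))).toReal := by
  have hR0 : 0 < R := by linarith
  have hχc : HasCompactSupport χ := by rw [hχ]; exact hasCompactSupport_cutoffScale hχb0 hR0
  have hχ3 : ContDiff ℝ 3 χ := by rw [hχ]; exact hχb.comp (contDiff_const_smul _)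
  have hχcont : Continuous χ := hχ3.continuous
  have hU2 : ContDiff ℝ 2 U := hU.of_le (by norm_num)
  have hcurlU2 : ContDiff ℝ 2 (curl U) := contDiff_curl (n := 2) (by exact_mod_cast hU)
  have hcurlU1 : ContDiff ℝ 1 (curl U) := hcurlU2.of_le (by norm_num)
  -- the field `Φ₂ = χ Ω`
  have hΦ : ContDiff ℝ 1 fun z => χ z • curl U z := (hχ3.of_le (by norm_num)).smul hcurlU1
  have hΦc : HasCompactSupport fun z => χ z • curl U z := hχc.smul_right
  have c1 : Continuous fun y => fderiv ℝ (fun z => χ z • curl U z) y := hΦ.continuous_fderiv one_ne_zero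
  have c2 : HasCompactSupport fun y => fderiv ℝ (fun z => χ z • curl U z) y := hΦc.fderiv ℝ
  have c3 : HasCompactSupport fun y => ‖fderiv ℝ (fun z => χ z • curl U z) y‖ ^ 2 :=
    c2.norm.comp_left (g := fun t : ℝ => t ^ 2) (by simp)
  have iL : Integrable fun y => ‖fderiv ℝ (fun z => χ z • curl U z) y‖ ^ 2 :=
    (c1.norm.pow 2).integrable_of_hasCompactSupport c3
  have iD : Integrable fun y => 2 * (χ y ^ 2 * frobeniusNormSq (fderiv ℝ (curl U) y)) :=
    (integrable_cutoff_sq_mul hχc hχcont (continuous_frobeniusNormSq_fderiv_of_contDiff hcurlU1)).const_mul 2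
  have s := integral_le_of_le_add_indicator iL iD
    (sq_norm_fderiv_smul_curl_le hχb hχb1 hχb0 hC₁ hR hU hK h1 hχ)
  rw [integral_const_mul] at s
  exact s

end SliceIntegrals


section SliceStretch

-- nested operator types
set_option maxSynthPendingDepth 3

variable {χb : EuclideanSpace ℝ (Fin 3) → ℝ} {U V : EuclideanSpace ℝ (Fin 3) → EuclideanSpace ℝ (Fin 3)}
  {χS χ : EuclideanSpace ℝ (Fin 3) → ℝ} {R C₁ C₂ Cu K K₂ : ℝ}

/-- **Pointwise bound of the stretching density**: with `w = χΩ`, `Ω = curl U`,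
`|χ² ⟪Ω, DU Ω⟫| ≤ Σₖ ‖w‖ (‖DV eₖ‖ ‖w‖)` (on `supp χ ⊆ B(0,2R)` one has `DU = DV`, and
`DV w = Σₖ wₖ DV eₖ` with `|wₖ| ≤ ‖w‖`). [folklore] -/
theorem abs_stretch_density_le (hχb1 : ∀ x, ‖x‖ ≤ 1 → χb x = 1)
    (hχb0 : ∀ x, 2 ≤ ‖x‖ → χb x = 0) (hR : 1 ≤ R)
    (hχS : χS = fun y => χb ((2 * R)⁻¹ • y)) (hχ : χ = fun y => χb (R⁻¹ • y))
    (hV : V = fun y => χS y • U y) (y : EuclideanSpace ℝ (Fin 3)) :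
    |χ y ^ 2 * ⟪curl U y, fderiv ℝ U y (curl U y)⟫| ≤
      ∑ k : Fin 3, ‖χ y • curl U y‖ *
        (‖fderiv ℝ V y (EuclideanSpace.basisFun (Fin 3) ℝ k)‖ * ‖χ y • curl U y‖) := by
  have hR0 : 0 < R := by linarith
  have hsum0 : 0 ≤ ∑ k : Fin 3, ‖χ y • curl U y‖ *
      (‖fderiv ℝ V y (EuclideanSpace.basisFun (Fin 3) ℝ k)‖ * ‖χ y • curl U y‖) :=
    Finset.sum_nonneg fun k _ => by positivity
  rcases lt_or_ge ‖y‖ (2 * R) with hy2 | hy2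
  · have hVU := sliceV_eventuallyEq hχb1 hR0 hχS hV hy2
    have hD : fderiv ℝ U y = fderiv ℝ V y := hVU.fderiv_eq.symm
    set w : EuclideanSpace ℝ (Fin 3) := χ y • curl U y with hw
    have e1 : χ y ^ 2 * ⟪curl U y, fderiv ℝ U y (curl U y)⟫ = ⟪w, fderiv ℝ V y w⟫ := by
      rw [hw, map_smul, inner_smul_left, inner_smul_right, hD]
      simp only [conj_trivial]
      ring
    rw [e1]
    -- expand `w` in the standard basis inside `DV`
    have hexp : fderiv ℝ V y w =
        ∑ k : Fin 3, w k • fderiv ℝ V y (EuclideanSpace.basisFun (Fin 3) ℝ k) := by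
      conv_lhs => rw [← (EuclideanSpace.basisFun (Fin 3) ℝ).sum_repr' w]
      rw [map_sum]
      refine Finset.sum_congr rfl fun k _ => ?_
      rw [map_smul, EuclideanSpace.basisFun_inner]
    calc |⟪w, fderiv ℝ V y w⟫| ≤ ‖w‖ * ‖fderiv ℝ V y w‖ := abs_real_inner_le_norm _ _
      _ ≤ ‖w‖ * ∑ k : Fin 3, ‖w‖ * ‖fderiv ℝ V y (EuclideanSpace.basisFun (Fin 3) ℝ k)‖ := by
          refine mul_le_mul_of_nonneg_left ?_ (norm_nonneg _)
          rw [hexp]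
          refine (norm_sum_le _ _).trans (Finset.sum_le_sum fun k _ => ?_)
          rw [norm_smul]
          exact mul_le_mul_of_nonneg_right (PiLp.norm_apply_le w k) (norm_nonneg _)
      _ = ∑ k : Fin 3, ‖w‖ * (‖fderiv ℝ V y (EuclideanSpace.basisFun (Fin 3) ℝ k)‖ * ‖w‖) := by
          rw [Finset.mul_sum]
          exact Finset.sum_congr rfl fun k _ => by ring
  · have hχ0 : χ y = 0 := by rw [hχ]; exact cutoffScale_eq_zero hχb0 hR0 hy2
    rw [hχ0]
    simp only [zero_pow two_ne_zero, zero_mul, abs_zero, zero_smul, norm_zero, mul_zero,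
      Finset.sum_const_zero, le_refl]

end SliceStretch

section SliceStretchIntegral

-- nested operator types
set_option maxSynthPendingDepth 3

variable {χb : EuclideanSpace ℝ (Fin 3) → ℝ} {U V : EuclideanSpace ℝ (Fin 3) → EuclideanSpace ℝ (Fin 3)}
  {χS χ : EuclideanSpace ℝ (Fin 3) → ℝ} {R C₁ C₂ Cu K K₂ : ℝ}

/-- `(a²)^{3/2} = a³` for `a ≥ 0`. [folklore] -/
theorem sq_rpow_three_halves_of_nonneg {a : ℝ} (ha : 0 ≤ a) : (a ^ 2) ^ (3 / 2 : ℝ) = a ^ 3 := by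
  rw [← Real.rpow_natCast a 2, ← Real.rpow_mul ha]
  norm_num

set_option maxHeartbeats 800000 in
/-- **The stretching term against the trilinear estimate** (Pineau–Vicol (9.11)–(9.12), here via
`L²` div–curl identities instead of the `L⁴` div–curl estimate): with `a = K_S + 1`
(`K_S` Mathlib's Sobolev constant `eLpNormLESNormFDerivOfEqInnerConst volume 2`),
`F² = ∫χ²|Ω|² ≤ θ²`, `D² = ∫χ²|DΩ|²_F`,
`|2∫χ²⟨Ω, DU Ω⟩| ≤ θ a³ (3/2 F² + 27/4 D² + 3/4 s_A + 9/4 (s_B + s_C))`,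
where `s_A, s_B, s_C = O(R⁻¹)` are the cut-off errors of
`integral_sq_norm_fderiv_apply_sliceV_le`, `integral_sq_norm_fderiv_fderiv_apply_sliceV_le`,
`integral_sq_norm_fderiv_smul_curl_le`. [cite: PineauVicol2026, (9.11)–(9.12), arXiv:2607.09619 pp. 31–32] -/
theorem abs_integral_stretch_le (hχb : ContDiff ℝ 3 χb) (hχb1 : ∀ x, ‖x‖ ≤ 1 → χb x = 1)
    (hχb0 : ∀ x, 2 ≤ ‖x‖ → χb x = 0) (hχb01 : ∀ x, |χb x| ≤ 1) (hC₁0 : 0 ≤ C₁) (hC₂0 : 0 ≤ C₂)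
    (hC₁ : ∀ x, ‖fderiv ℝ χb x‖ ≤ C₁) (hC₂ : ∀ x, ‖iteratedFDeriv ℝ 2 χb x‖ ≤ C₂) (hR : 1 ≤ R)
    (hU : ContDiff ℝ 3 U)
    (hdiv : ∀ y : EuclideanSpace ℝ (Fin 3), ‖y‖ < 5 * R → VectorCalculus.divergence U y = 0)
    (hCu : 0 ≤ Cu) (hK : 0 ≤ K) (hK₂ : 0 ≤ K₂)
    (h0 : ∀ y : EuclideanSpace ℝ (Fin 3), ‖y‖ ≤ 4 * R → ‖U y‖ ≤ Cu / (1 + ‖y‖))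
    (h1 : ∀ y : EuclideanSpace ℝ (Fin 3), ‖y‖ ≤ 4 * R → ‖fderiv ℝ U y‖ ≤ K / (1 + ‖y‖) ^ 2)
    (h2 : ∀ y : EuclideanSpace ℝ (Fin 3), ‖y‖ ≤ 4 * R →
      ‖iteratedFDeriv ℝ 2 U y‖ ≤ K₂ / (1 + ‖y‖) ^ 3)
    (hχS : χS = fun y => χb ((2 * R)⁻¹ • y)) (hχ : χ = fun y => χb (R⁻¹ • y))
    (hV : V = fun y => χS y • U y) {θ : ℝ} (hθ : 0 ≤ θ)
    (hF : ∫ y, χ y ^ 2 * ‖curl U y‖ ^ 2 ≤ θ ^ 2) :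
    |2 * ∫ y, χ y ^ 2 * ⟪curl U y, fderiv ℝ U y (curl U y)⟫| ≤
      θ * ((eLpNormLESNormFDerivOfEqInnerConst (volume : Measure (EuclideanSpace ℝ (Fin 3))) 2 : ℝ) + 1) ^ 3 *
        (3 / 2 * (∫ y, χ y ^ 2 * ‖curl U y‖ ^ 2) +
          27 / 4 * (∫ y, χ y ^ 2 * frobeniusNormSq (fderiv ℝ (curl U) y)) +
          3 / 4 * ((‖curlCLM‖ ^ 2 * ((K + C₁ * Cu) / R ^ 2) ^ 2 +
              ‖(traceCLM : (EuclideanSpace ℝ (Fin 3) →L[ℝ] EuclideanSpace ℝ (Fin 3)) →L[ℝ] ℝ)‖ ^ 2 *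
                ((K + C₁ * Cu) / R ^ 2) ^ 2) *
              (volume (closedBall (0 : EuclideanSpace ℝ (Fin 3)) (4 * R))).toReal) +
          9 / 4 * ((3 * ‖curlCLM‖ ^ 2 * ((K₂ + 2 * C₁ * K + C₂ * Cu) / R ^ 3) ^ 2 +
                ‖(traceCLM : (EuclideanSpace ℝ (Fin 3) →L[ℝ] EuclideanSpace ℝ (Fin 3)) →L[ℝ] ℝ)‖ ^ 2 *
                  ((K₂ + 2 * C₁ * K + C₂ * Cu) / R ^ 3) ^ 2) *
                (volume (closedBall (0 : EuclideanSpace ℝ (Fin 3)) (4 * R))).toReal +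
              (2 * (C₁ / R) ^ 2 * (‖curlCLM‖ ^ 2 * (K / R ^ 2) ^ 2)) *
                (volume (closedBall (0 : EuclideanSpace ℝ (Fin 3)) (4 * R))).toReal)) := by
  have hR0 : 0 < R := by linarith
  -- name the quantities
  obtain ⟨F2, hF2⟩ : ∃ F2 : ℝ, (∫ y, χ y ^ 2 * ‖curl U y‖ ^ 2) = F2 := ⟨_, rfl⟩
  obtain ⟨D2, hD2⟩ : ∃ D2 : ℝ, (∫ y, χ y ^ 2 * frobeniusNormSq (fderiv ℝ (curl U) y)) = D2 := ⟨_, rfl⟩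
  obtain ⟨sA, hsA⟩ : ∃ s : ℝ, (‖curlCLM‖ ^ 2 * ((K + C₁ * Cu) / R ^ 2) ^ 2 +
      ‖(traceCLM : (EuclideanSpace ℝ (Fin 3) →L[ℝ] EuclideanSpace ℝ (Fin 3)) →L[ℝ] ℝ)‖ ^ 2 *
        ((K + C₁ * Cu) / R ^ 2) ^ 2) *
      (volume (closedBall (0 : EuclideanSpace ℝ (Fin 3)) (4 * R))).toReal = s := ⟨_, rfl⟩
  obtain ⟨sB, hsB⟩ : ∃ s : ℝ, (3 * ‖curlCLM‖ ^ 2 * ((K₂ + 2 * C₁ * K + C₂ * Cu) / R ^ 3) ^ 2 +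
      ‖(traceCLM : (EuclideanSpace ℝ (Fin 3) →L[ℝ] EuclideanSpace ℝ (Fin 3)) →L[ℝ] ℝ)‖ ^ 2 *
        ((K₂ + 2 * C₁ * K + C₂ * Cu) / R ^ 3) ^ 2) *
      (volume (closedBall (0 : EuclideanSpace ℝ (Fin 3)) (4 * R))).toReal = s := ⟨_, rfl⟩
  obtain ⟨sC, hsC⟩ : ∃ s : ℝ, (2 * (C₁ / R) ^ 2 * (‖curlCLM‖ ^ 2 * (K / R ^ 2) ^ 2)) *
      (volume (closedBall (0 : EuclideanSpace ℝ (Fin 3)) (4 * R))).toReal = s := ⟨_, rfl⟩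
  obtain ⟨a, ha⟩ : ∃ a : ℝ,
      (eLpNormLESNormFDerivOfEqInnerConst (volume : Measure (EuclideanSpace ℝ (Fin 3))) 2 : ℝ) + 1 = a :=
    ⟨_, rfl⟩
  have ha1 : 1 ≤ a := by rw [← ha]; linarith [NNReal.coe_nonneg (eLpNormLESNormFDerivOfEqInnerConst
    (volume : Measure (EuclideanSpace ℝ (Fin 3))) 2)]
  have ha0 : 0 ≤ a := by linarith
  have hKa : (eLpNormLESNormFDerivOfEqInnerConst (volume : Measure (EuclideanSpace ℝ (Fin 3))) 2 : ℝ) ≤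
      a ^ 2 := by
    rw [← ha]; nlinarith [NNReal.coe_nonneg (eLpNormLESNormFDerivOfEqInnerConst
      (volume : Measure (EuclideanSpace ℝ (Fin 3))) 2)]
  rw [hF2] at hF ⊢
  rw [hD2, hsA, hsB, hsC, ha]
  -- nonnegativity of the quantities
  have hF2_0 : 0 ≤ F2 := by rw [← hF2]; exact integral_nonneg fun y => by positivity
  have hD2_0 : 0 ≤ D2 := by
    rw [← hD2]; exact integral_nonneg fun y => mul_nonneg (sq_nonneg _) (frobeniusNormSq_nonneg _)
  -- regularity of the three fields
  have hV3 : ContDiff ℝ 3 V := sliceV_contDiff hχb hU hχS hV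
  have hV1 : ContDiff ℝ 1 V := hV3.of_le (by norm_num)
  have hVc : HasCompactSupport V := sliceV_hasCompactSupport hχb0 hR0 hχS hV
  have hχc : HasCompactSupport χ := by rw [hχ]; exact hasCompactSupport_cutoffScale hχb0 hR0
  have hχ3 : ContDiff ℝ 3 χ := by rw [hχ]; exact hχb.comp (contDiff_const_smul _)
  have hcurlU2 : ContDiff ℝ 2 (curl U) := contDiff_curl (n := 2) (by exact_mod_cast hU)
  have hcurlU1 : ContDiff ℝ 1 (curl U) := hcurlU2.of_le (by norm_num)
  have hw1 : ContDiff ℝ 1 fun z => χ z • curl U z := (hχ3.of_le (by norm_num)).smul hcurlU1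
  have hwc : HasCompactSupport fun z => χ z • curl U z := hχc.smul_right
  have hwL2 : MemLp (fun z => χ z • curl U z) 2 (volume : Measure (EuclideanSpace ℝ (Fin 3))) :=
    hw1.continuous.memLp_of_hasCompactSupport hwc
  have hΦ1 : ∀ k : Fin 3, ContDiff ℝ 1 fun y => fderiv ℝ V y (EuclideanSpace.basisFun (Fin 3) ℝ k) :=
    fun k => (hV3.fderiv_right (m := 1) (by norm_num)).clm_apply contDiff_const
  have hΦ1c : ∀ k : Fin 3, HasCompactSupport fun y => fderiv ℝ V y (EuclideanSpace.basisFun (Fin 3) ℝ k) :=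
    fun k => hVc.fderiv_apply ℝ _
  -- the trilinear estimate for each `k`, `ε = 1`, Sobolev constant `≤ a²`
  have hT : ∀ k : Fin 3, ∫ y, ‖χ y • curl U y‖ *
      (‖fderiv ℝ V y (EuclideanSpace.basisFun (Fin 3) ℝ k)‖ * ‖χ y • curl U y‖) ≤
      θ * a ^ 3 * (1 / 8 * ((F2 + sA) + F2) + 3 / 8 * ((D2 + sB) + (2 * D2 + sC))) := by
    intro k
    have h := integral_norm_mul_norm_mul_norm_le (volume : Measure (EuclideanSpace ℝ (Fin 3)))
      finrank_euclideanSpace_fin hwL2 (hΦ1 k) (hΦ1c k) hw1 hwc hKa one_pos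
    rw [inv_one, one_pow, one_mul, one_mul, sq_rpow_three_halves_of_nonneg ha0] at h
    refine h.trans ?_
    -- the four `L²` quantities
    have q1 := integral_sq_norm_fderiv_apply_sliceV_le hχb hχb1 hχb0 hχb01 hC₁0 hC₂0 hC₁ hC₂ hR hU
      hdiv hCu hK hK₂ h0 h1 h2 hχS hχ hV k
    have q2 := integral_sq_norm_smul_curl_eq χ U
    have q3 := integral_sq_norm_fderiv_fderiv_apply_sliceV_le hχb hχb1 hχb0 hχb01 hC₁0 hC₂0 hC₁ hC₂
      hR hU hdiv hCu hK hK₂ h0 h1 h2 hχS hχ hV k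
    have q4 := integral_sq_norm_fderiv_smul_curl_le hχb hχb1 hχb0 hC₁ hR hU hK h1 hχ
    rw [hF2, hsA] at q1
    rw [hF2] at q2
    rw [hD2, hsB] at q3
    rw [hD2, hsC] at q4
    have hsqrt : Real.sqrt (∫ y, ‖χ y • curl U y‖ ^ 2) ≤ θ := by
      rw [q2]
      calc Real.sqrt F2 ≤ Real.sqrt (θ ^ 2) := Real.sqrt_le_sqrt hF
        _ = θ := Real.sqrt_sq hθ
    have hin1 : 0 ≤ (∫ y, ‖fderiv ℝ V y (EuclideanSpace.basisFun (Fin 3) ℝ k)‖ ^ 2) +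
        ∫ y, ‖χ y • curl U y‖ ^ 2 :=
      add_nonneg (integral_nonneg fun _ => sq_nonneg _) (integral_nonneg fun _ => sq_nonneg _)
    have hin2 : 0 ≤ (∫ y, ‖fderiv ℝ (fun y => fderiv ℝ V y (EuclideanSpace.basisFun (Fin 3) ℝ k)) y‖ ^ 2) +
        ∫ y, ‖fderiv ℝ (fun z => χ z • curl U z) y‖ ^ 2 :=
      add_nonneg (integral_nonneg fun _ => sq_nonneg _) (integral_nonneg fun _ => sq_nonneg _)
    have hbr : 0 ≤ 1 / 8 * ((∫ y, ‖fderiv ℝ V y (EuclideanSpace.basisFun (Fin 3) ℝ k)‖ ^ 2) +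
        ∫ y, ‖χ y • curl U y‖ ^ 2) +
        3 / 8 * ((∫ y, ‖fderiv ℝ (fun y => fderiv ℝ V y (EuclideanSpace.basisFun (Fin 3) ℝ k)) y‖ ^ 2) +
          ∫ y, ‖fderiv ℝ (fun z => χ z • curl U z) y‖ ^ 2) := by positivity
    calc Real.sqrt (∫ y, ‖χ y • curl U y‖ ^ 2) * a ^ 3 *
          (1 / 8 * ((∫ y, ‖fderiv ℝ V y (EuclideanSpace.basisFun (Fin 3) ℝ k)‖ ^ 2) +
              ∫ y, ‖χ y • curl U y‖ ^ 2) +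
            3 / 8 * ((∫ y, ‖fderiv ℝ (fun y => fderiv ℝ V y (EuclideanSpace.basisFun (Fin 3) ℝ k)) y‖ ^ 2) +
              ∫ y, ‖fderiv ℝ (fun z => χ z • curl U z) y‖ ^ 2))
        ≤ θ * a ^ 3 *
          (1 / 8 * ((∫ y, ‖fderiv ℝ V y (EuclideanSpace.basisFun (Fin 3) ℝ k)‖ ^ 2) +
              ∫ y, ‖χ y • curl U y‖ ^ 2) +
            3 / 8 * ((∫ y, ‖fderiv ℝ (fun y => fderiv ℝ V y (EuclideanSpace.basisFun (Fin 3) ℝ k)) y‖ ^ 2) +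
              ∫ y, ‖fderiv ℝ (fun z => χ z • curl U z) y‖ ^ 2)) := by
          exact mul_le_mul_of_nonneg_right
            (mul_le_mul_of_nonneg_right hsqrt (by positivity)) hbr
      _ ≤ θ * a ^ 3 * (1 / 8 * ((F2 + sA) + F2) + 3 / 8 * ((D2 + sB) + (2 * D2 + sC))) := by
          refine mul_le_mul_of_nonneg_left ?_ (by positivity)
          rw [q2]
          gcongr
  -- integrability of the two densities
  have hwcont : Continuous fun z => χ z • curl U z := hw1.continuous
  have iabs : Integrable fun y => |χ y ^ 2 * ⟪curl U y, fderiv ℝ U y (curl U y)⟫| := by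
    have hc : Continuous fun y => χ y ^ 2 * ⟪curl U y, fderiv ℝ U y (curl U y)⟫ :=
      (hχ3.continuous.pow 2).mul ((continuous_curl (hU.of_le (by norm_num))).inner
        (((hU.continuous_fderiv (by norm_num)).clm_apply (continuous_curl (hU.of_le (by norm_num))))))
    have hs : HasCompactSupport fun y => χ y ^ 2 * ⟪curl U y, fderiv ℝ U y (curl U y)⟫ :=
      (hχc.comp_left (g := fun t : ℝ => t ^ 2) (by simp)).mul_right
    exact (hc.integrable_of_hasCompactSupport hs).abs
  have isum : Integrable fun y => ∑ k : Fin 3, ‖χ y • curl U y‖ *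
      (‖fderiv ℝ V y (EuclideanSpace.basisFun (Fin 3) ℝ k)‖ * ‖χ y • curl U y‖) := by
    refine integrable_finsetSum _ fun k _ => ?_
    have hc : Continuous fun y => ‖χ y • curl U y‖ *
        (‖fderiv ℝ V y (EuclideanSpace.basisFun (Fin 3) ℝ k)‖ * ‖χ y • curl U y‖) :=
      hwcont.norm.mul (((hV1.continuous_fderiv one_ne_zero).clm_apply continuous_const).norm.mul
        hwcont.norm)
    have hs : HasCompactSupport fun y => ‖χ y • curl U y‖ *
        (‖fderiv ℝ V y (EuclideanSpace.basisFun (Fin 3) ℝ k)‖ * ‖χ y • curl U y‖) :=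
      hwc.norm.mul_right
    exact hc.integrable_of_hasCompactSupport hs
  -- assemble
  have hpt := abs_stretch_density_le (U := U) hχb1 hχb0 hR hχS hχ hV
  calc |2 * ∫ y, χ y ^ 2 * ⟪curl U y, fderiv ℝ U y (curl U y)⟫|
      = 2 * |∫ y, χ y ^ 2 * ⟪curl U y, fderiv ℝ U y (curl U y)⟫| := by
        rw [abs_mul, abs_of_pos two_pos]
    _ ≤ 2 * ∫ y, |χ y ^ 2 * ⟪curl U y, fderiv ℝ U y (curl U y)⟫| := by
        gcongr; exact abs_integral_le_integral_abs
    _ ≤ 2 * ∫ y, ∑ k : Fin 3, ‖χ y • curl U y‖ *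
          (‖fderiv ℝ V y (EuclideanSpace.basisFun (Fin 3) ℝ k)‖ * ‖χ y • curl U y‖) := by
        exact mul_le_mul_of_nonneg_left (integral_mono iabs isum hpt) (by norm_num)
    _ = 2 * ∑ k : Fin 3, ∫ y, ‖χ y • curl U y‖ *
          (‖fderiv ℝ V y (EuclideanSpace.basisFun (Fin 3) ℝ k)‖ * ‖χ y • curl U y‖) := by
        congr 1
        refine integral_finsetSum _ fun k _ => ?_
        exact (hwcont.norm.mul (((hV1.continuous_fderiv one_ne_zero).clm_apply continuous_const).norm.mul
          hwcont.norm)).integrable_of_hasCompactSupport hwc.norm.mul_right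
    _ ≤ 2 * ∑ _k : Fin 3, θ * a ^ 3 * (1 / 8 * ((F2 + sA) + F2) + 3 / 8 * ((D2 + sB) + (2 * D2 + sC))) := by
        gcongr with k _; exact hT k
    _ = θ * a ^ 3 * (3 / 2 * F2 + 27 / 4 * D2 + 3 / 4 * sA + 9 / 4 * (sB + sC)) := by
        rw [Finset.sum_const, Finset.card_univ, Fintype.card_fin]
        simp only [nsmul_eq_mul, Nat.cast_ofNat]
        ring

end SliceStretchIntegral


section SliceEterm

-- nested operator types
set_option maxSynthPendingDepth 3

variable {χb : EuclideanSpace ℝ (Fin 3) → ℝ} {U : EuclideanSpace ℝ (Fin 3) → EuclideanSpace ℝ (Fin 3)}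
  {χ η : EuclideanSpace ℝ (Fin 3) → ℝ} {R C₁ C₂ Cu K : ℝ}

/-- **The cut-off error term `E`** (Pineau–Vicol (9.10)): with `η = χ²`, `χ = χ̄(·/R)`,
`|∫ (½ Dη(y)[y] + Δη(y) + Dη(y)[U(y)]) |curl U(y)|² dy| ≤ M_E · vol(B̄(0,4R))`,
`M_E = (2C₁ + 6(C₂ + C₁²) + 2C₁C_u) κ² K² / R⁴` (the integrand lives on `R ≤ |y| ≤ 2R`, where
`|Dη| ≤ 2C₁/R`, `|D²η| ≤ 2(C₂ + C₁²)/R²`, `|U| ≤ C_u`, `|curl U|² ≤ κ²K²/R⁴`). [cite: PineauVicol2026, (9.10), arXiv:2607.09619 p. 31] -/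
theorem abs_integral_Eterm_le (hχb : ContDiff ℝ 3 χb) (hχb1 : ∀ x, ‖x‖ ≤ 1 → χb x = 1)
    (hχb0 : ∀ x, 2 ≤ ‖x‖ → χb x = 0) (hχb01 : ∀ x, |χb x| ≤ 1) (hC₁0 : 0 ≤ C₁) (hC₂0 : 0 ≤ C₂)
    (hC₁ : ∀ x, ‖fderiv ℝ χb x‖ ≤ C₁) (hC₂ : ∀ x, ‖iteratedFDeriv ℝ 2 χb x‖ ≤ C₂) (hR : 1 ≤ R)
    (hU : ContDiff ℝ 3 U) (hCu : 0 ≤ Cu) (hK : 0 ≤ K)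
    (h0 : ∀ y : EuclideanSpace ℝ (Fin 3), ‖y‖ ≤ 4 * R → ‖U y‖ ≤ Cu / (1 + ‖y‖))
    (h1 : ∀ y : EuclideanSpace ℝ (Fin 3), ‖y‖ ≤ 4 * R → ‖fderiv ℝ U y‖ ≤ K / (1 + ‖y‖) ^ 2)
    (hχ : χ = fun y => χb (R⁻¹ • y)) (hη : η = fun y => χ y ^ 2) :
    |∫ y, (1 / 2 * fderiv ℝ η y y + (Δ η) y + fderiv ℝ η y (U y)) * ‖curl U y‖ ^ 2| ≤
      ((2 * C₁ + 6 * (C₂ + C₁ ^ 2) + 2 * C₁ * Cu) * (‖curlCLM‖ ^ 2 * (K / R ^ 2) ^ 2)) *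
        (volume (closedBall (0 : EuclideanSpace ℝ (Fin 3)) (4 * R))).toReal := by
  have hR0 : 0 < R := by linarith
  obtain ⟨κ, hκ⟩ : ∃ κ : ℝ, ‖curlCLM‖ = κ := ⟨_, rfl⟩
  rw [hκ]
  obtain ⟨M, hM⟩ : ∃ M : ℝ,
      (2 * C₁ + 6 * (C₂ + C₁ ^ 2) + 2 * C₁ * Cu) * (κ ^ 2 * (K / R ^ 2) ^ 2) = M := ⟨_, rfl⟩
  rw [hM]
  have hM0 : 0 ≤ M := by rw [← hM]; positivity
  -- regularity
  have hχ3 : ContDiff ℝ 3 χ := by rw [hχ]; exact hχb.comp (contDiff_const_smul _)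
  have hηs : η = fun y => χ y • χ y := by rw [hη]; funext y; rw [smul_eq_mul, sq]
  have hη3 : ContDiff ℝ 3 η := by rw [hηs]; exact hχ3.smul hχ3
  have hη2 : ContDiff ℝ 2 η := hη3.of_le (by norm_num)
  have hχc : HasCompactSupport χ := by rw [hχ]; exact hasCompactSupport_cutoffScale hχb0 hR0
  have hU1 : ContDiff ℝ 1 U := hU.of_le (by norm_num)
  -- pointwise bound of the integrand
  have hpt : ∀ y, |(1 / 2 * fderiv ℝ η y y + (Δ η) y + fderiv ℝ η y (U y)) * ‖curl U y‖ ^ 2| ≤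
      (closedBall (0 : EuclideanSpace ℝ (Fin 3)) (4 * R)).indicator (fun _ => M) y := by
    intro y
    have hind0 : 0 ≤ (closedBall (0 : EuclideanSpace ℝ (Fin 3)) (4 * R)).indicator (fun _ => M) y :=
      Set.indicator_nonneg (fun _ _ => hM0) _
    -- where `η` is locally constant the integrand vanishes
    have hconst : ∀ c : ℝ, (η =ᶠ[𝓝 y] fun _ => c) →
        |(1 / 2 * fderiv ℝ η y y + (Δ η) y + fderiv ℝ η y (U y)) * ‖curl U y‖ ^ 2| ≤
          (closedBall (0 : EuclideanSpace ℝ (Fin 3)) (4 * R)).indicator (fun _ => M) y := by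
      intro c hc
      have hD : fderiv ℝ η y = 0 := by rw [hc.fderiv_eq, fderiv_const_apply]
      have hL : (Δ η) y = 0 := by
        rw [(InnerProductSpace.laplacian_congr_nhds hc).eq_of_nhds, InnerProductSpace.laplacian_const]
        rfl
      have hz : (1 / 2 * fderiv ℝ η y y + (Δ η) y + fderiv ℝ η y (U y)) * ‖curl U y‖ ^ 2 = 0 := by
        rw [hD, hL]; simp
      rw [hz, abs_zero]
      exact hind0
    rcases lt_or_ge ‖y‖ R with hy1 | hy1
    · refine hconst 1 ?_
      have h1 : χ =ᶠ[𝓝 y] fun _ => (1 : ℝ) := by rw [hχ]; exact cutoffScale_eventuallyEq_one hχb1 hR0 hy1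
      filter_upwards [h1] with z hz
      rw [hη]
      show χ z ^ 2 = 1
      rw [hz]; norm_num
    · rcases le_or_gt ‖y‖ (2 * R) with hy2 | hy2
      · -- the annulus `R ≤ |y| ≤ 2R`
        have hyin : y ∈ closedBall (0 : EuclideanSpace ℝ (Fin 3)) (4 * R) :=
          mem_closedBall_zero_iff.2 (by linarith)
        rw [Set.indicator_of_mem hyin]
        -- bounds of `χ`, `Dχ`, `D²χ` at `y`
        have bχ : |χ y| ≤ 1 := by rw [hχ]; exact hχb01 _
        have bDχ : ‖fderiv ℝ χ y‖ ≤ C₁ / R := by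
          rw [hχ]; exact norm_fderiv_cutoffScale_le (hχb.of_le (by norm_num)) hC₁ hR0 y
        have bD2χ : ‖iteratedFDeriv ℝ 2 χ y‖ ≤ C₂ / R ^ 2 := by
          rw [hχ]; exact norm_iteratedFDeriv_two_cutoffScale_le (hχb.of_le (by norm_num)) hC₂ hR0 y
        have hCR : C₁ / R ≤ C₁ := div_le_self hC₁0 hR
        have hCR2 : C₂ / R ^ 2 ≤ C₂ := div_le_self hC₂0 (one_le_pow₀ hR)
        have hC1R2 : (C₁ / R) * (C₁ / R) ≤ C₁ ^ 2 := by
          rw [sq]; exact mul_le_mul hCR hCR (by positivity) hC₁0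
        -- `‖Dη‖ ≤ 2C₁/R`
        have bDη : ‖fderiv ℝ η y‖ ≤ 2 * (C₁ / R) := by
          rw [hηs]
          refine (norm_fderiv_smul_le_fin3 (hχ3.differentiable (by norm_num) y)
            (hχ3.differentiable (by norm_num) y)).trans ?_
          rw [Real.norm_eq_abs]
          nlinarith [norm_nonneg (fderiv ℝ χ y)]
        -- `‖D²η‖ ≤ 2(C₂ + C₁²)` (using `R ≥ 1`)
        have bD2η : ‖iteratedFDeriv ℝ 2 η y‖ ≤ 2 * (C₂ + C₁ ^ 2) := by
          rw [hηs]
          refine (norm_iteratedFDeriv_two_smul_le (hχ3.of_le (by norm_num)) (hχ3.of_le (by norm_num))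
            y).trans ?_
          rw [Real.norm_eq_abs]
          have t1 : |χ y| * ‖iteratedFDeriv ℝ 2 χ y‖ ≤ 1 * C₂ :=
            mul_le_mul bχ (bD2χ.trans hCR2) (norm_nonneg _) zero_le_one
          have t2 : 2 * ‖fderiv ℝ χ y‖ * ‖fderiv ℝ χ y‖ ≤ 2 * C₁ ^ 2 := by
            rw [mul_assoc]
            exact mul_le_mul_of_nonneg_left ((mul_le_mul bDχ bDχ (norm_nonneg _)
              (by positivity)).trans hC1R2) (by norm_num)
          have t3 : ‖iteratedFDeriv ℝ 2 χ y‖ * |χ y| ≤ C₂ * 1 :=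
            mul_le_mul (bD2χ.trans hCR2) bχ (abs_nonneg _) hC₂0
          linarith
        -- the three coefficients
        have c1 : |1 / 2 * fderiv ℝ η y y| ≤ 2 * C₁ := by
          rw [abs_mul, abs_of_pos (by norm_num : (0 : ℝ) < 1 / 2)]
          have : |fderiv ℝ η y y| ≤ 2 * (C₁ / R) * (2 * R) := by
            rw [← Real.norm_eq_abs]
            refine (ContinuousLinearMap.le_opNorm _ _).trans ?_
            exact mul_le_mul bDη hy2 (norm_nonneg _) (by positivity)
          have e : 2 * (C₁ / R) * (2 * R) = 4 * C₁ := by field_simp; ring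
          linarith
        have c2 : |(Δ η) y| ≤ 6 * (C₂ + C₁ ^ 2) := by
          rw [← Real.norm_eq_abs]
          refine (norm_laplacian_le η y).trans ?_
          rw [finrank_euclideanSpace_fin, ← norm_iteratedFDeriv_two_eq_norm_fderiv_fderiv_fin3]
          push_cast
          nlinarith [norm_nonneg (iteratedFDeriv ℝ 2 η y)]
        have c3 : |fderiv ℝ η y (U y)| ≤ 2 * C₁ * Cu := by
          rw [← Real.norm_eq_abs]
          refine (ContinuousLinearMap.le_opNorm _ _).trans ?_
          have bU : ‖U y‖ ≤ Cu := (h0 y (by linarith)).trans (div_le_self hCu (by linarith [norm_nonneg y]))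
          calc ‖fderiv ℝ η y‖ * ‖U y‖ ≤ (2 * (C₁ / R)) * Cu :=
                mul_le_mul bDη bU (norm_nonneg _) (by positivity)
            _ ≤ 2 * C₁ * Cu := by nlinarith
        have cΩ : ‖curl U y‖ ^ 2 ≤ κ ^ 2 * (K / R ^ 2) ^ 2 := by
          have h1y := (h1 y (by linarith)).trans (typeI_bound_le_of_le hK hR0 (by linarith) 2)
          have hcu := norm_curl_le U y
          rw [hκ] at hcu
          have hκ0 : 0 ≤ κ := by rw [← hκ]; exact norm_nonneg _
          calc ‖curl U y‖ ^ 2 ≤ (κ * ‖fderiv ℝ U y‖) ^ 2 :=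
                pow_le_pow_left₀ (norm_nonneg _) hcu 2
            _ ≤ (κ * (K / R ^ 2)) ^ 2 :=
                pow_le_pow_left₀ (mul_nonneg hκ0 (norm_nonneg _))
                  (mul_le_mul_of_nonneg_left h1y hκ0) 2
            _ = κ ^ 2 * (K / R ^ 2) ^ 2 := by ring
        have csum : |1 / 2 * fderiv ℝ η y y + (Δ η) y + fderiv ℝ η y (U y)| ≤
            2 * C₁ + 6 * (C₂ + C₁ ^ 2) + 2 * C₁ * Cu :=
          ((abs_add_le _ _).trans (add_le_add ((abs_add_le _ _).trans (add_le_add c1 c2)) c3))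
        rw [abs_mul, abs_of_nonneg (sq_nonneg ‖curl U y‖), ← hM]
        exact mul_le_mul csum cΩ (sq_nonneg _) (by positivity)
      · refine hconst 0 ?_
        have h0' : χ =ᶠ[𝓝 y] fun _ => (0 : ℝ) := by rw [hχ]; exact cutoffScale_eventuallyEq_zero hχb0 hR0 hy2
        filter_upwards [h0'] with z hz
        rw [hη]
        show χ z ^ 2 = 0
        rw [hz]; norm_num
  -- integrability of the integrand
  have hint : Integrable fun y =>
      |(1 / 2 * fderiv ℝ η y y + (Δ η) y + fderiv ℝ η y (U y)) * ‖curl U y‖ ^ 2| := by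
    have hDη : Continuous fun y => fderiv ℝ η y := hη2.continuous_fderiv (by norm_num)
    have ca : Continuous fun y => 1 / 2 * fderiv ℝ η y y :=
      continuous_const.mul (hDη.clm_apply continuous_id)
    have cb : Continuous fun y => (Δ η) y := continuous_laplacian hη2
    have cc : Continuous fun y => fderiv ℝ η y (U y) := hDη.clm_apply hU.continuous
    have cd : Continuous fun y => ‖curl U y‖ ^ 2 := (continuous_curl hU1).norm.pow 2
    have hc : Continuous fun y => (1 / 2 * fderiv ℝ η y y + (Δ η) y + fderiv ℝ η y (U y)) *
        ‖curl U y‖ ^ 2 := ((ca.add cb).add cc).mul cd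
    -- compact support: the first factor vanishes off `supp χ ⊆ B̄(0, 2R)`
    have hs : HasCompactSupport fun y => (1 / 2 * fderiv ℝ η y y + (Δ η) y + fderiv ℝ η y (U y)) *
        ‖curl U y‖ ^ 2 := by
      refine HasCompactSupport.intro (isCompact_closedBall (0 : EuclideanSpace ℝ (Fin 3)) (2 * R))
        fun y hy => ?_
      rw [mem_closedBall_zero_iff, not_le] at hy
      have h0' : η =ᶠ[𝓝 y] fun _ => (0 : ℝ) := by
        have hc0 : χ =ᶠ[𝓝 y] fun _ => (0 : ℝ) := by
          rw [hχ]; exact cutoffScale_eventuallyEq_zero hχb0 hR0 hy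
        filter_upwards [hc0] with z hz
        rw [hη]
        show χ z ^ 2 = 0
        rw [hz]; norm_num
      have hD : fderiv ℝ η y = 0 := by rw [h0'.fderiv_eq, fderiv_const_apply]
      have hL : (Δ η) y = 0 := by
        rw [(InnerProductSpace.laplacian_congr_nhds h0').eq_of_nhds, InnerProductSpace.laplacian_const]
        rfl
      rw [hD, hL]
      simp
    have hI : Integrable fun y => (1 / 2 * fderiv ℝ η y y + (Δ η) y + fderiv ℝ η y (U y)) *
        ‖curl U y‖ ^ 2 := hc.integrable_of_hasCompactSupport hs
    exact hI.abs
  have s1 : |∫ y, (1 / 2 * fderiv ℝ η y y + (Δ η) y + fderiv ℝ η y (U y)) * ‖curl U y‖ ^ 2| ≤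
      ∫ y, |(1 / 2 * fderiv ℝ η y y + (Δ η) y + fderiv ℝ η y (U y)) * ‖curl U y‖ ^ 2| :=
    abs_integral_le_integral_abs
  have s2 := integral_mono hint (integrable_indicator_closedBall_const_fin3 M (4 * R)) hpt
  rw [integral_indicator_closedBall_const M (4 * R)] at s2
  exact s1.trans s2

end SliceEterm


section SliceMain

-- nested operator types
set_option maxSynthPendingDepth 3

/-- `vol(B̄(0, 4R)) = 64 R³ vol(B(0,1))` in `ℝ³`. [folklore] -/
theorem volume_real_closedBall_four_mul {R : ℝ} (hR : 0 ≤ R) :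
    (volume (closedBall (0 : EuclideanSpace ℝ (Fin 3)) (4 * R))).toReal =
      64 * R ^ 3 * (volume (ball (0 : EuclideanSpace ℝ (Fin 3)) 1)).toReal := by
  have h := Measure.addHaar_real_closedBall (volume : Measure (EuclideanSpace ℝ (Fin 3)))
    (0 : EuclideanSpace ℝ (Fin 3)) (r := 4 * R) (by positivity)
  rw [finrank_euclideanSpace_fin] at h
  rw [← measureReal_def, ← measureReal_def, h]
  ring

set_option maxHeartbeats 800000 in
/-- **The fixed-slice enstrophy inequality** (the core of Pineau–Vicol, Lemma 9.4, (9.9)–(9.13),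
with the stretching term handled by `abs_integral_stretch_le` and the cut-off error by
`abs_integral_Eterm_le`): there is a universal `ϑ ∈ (0, 1]` such that for `θ ≤ ϑ` and Type I
constants `C_u, K, K₂` (orders `0, 1, 2`) and cut-off constants `C₁, C₂`, for all `R ≥ R₀`, every
`C³` profile `U`, divergence free on `B(0, 5R)` with the Type I bounds on `B̄(0, 4R)`, and with
`F² = ∫χ²|Ω|² ≤ θ²` (`Ω = curl U`, `χ = χ̄(·/R)`, `η = χ²`) satisfies
`−½F² + E − 2D² + S ≤ −¼F² + θ²/16`, where `D² = ∫χ²|DΩ|²_F`,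
`E = ∫(½Dη[y] + Δη + Dη[U])|Ω|²` and `S = 2∫χ²⟨Ω, DU Ω⟩` — the right-hand side of the
similarity-variable enstrophy identity `d/ds F² = −½F² + E − 2D² + S`. [cite: PineauVicol2026, Lemma 9.4, (9.9)–(9.13), arXiv:2607.09619 pp. 31–32] -/
theorem slice_enstrophy_ineq :
    ∃ ϑ : ℝ, 0 < ϑ ∧ ϑ ≤ 1 ∧ ∀ θ : ℝ, 0 < θ → θ ≤ ϑ →
      ∀ Cu K K₂ C₁ C₂ : ℝ, 0 ≤ Cu → 0 ≤ K → 0 ≤ K₂ → 0 ≤ C₁ → 0 ≤ C₂ →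
      ∃ R₀ : ℝ, 1 ≤ R₀ ∧ ∀ R : ℝ, R₀ ≤ R →
      ∀ (χb : EuclideanSpace ℝ (Fin 3) → ℝ)
        (U : EuclideanSpace ℝ (Fin 3) → EuclideanSpace ℝ (Fin 3))
        (χ η : EuclideanSpace ℝ (Fin 3) → ℝ),
        ContDiff ℝ 3 χb → (∀ x, ‖x‖ ≤ 1 → χb x = 1) → (∀ x, 2 ≤ ‖x‖ → χb x = 0) →
        (∀ x, |χb x| ≤ 1) → (∀ x, ‖fderiv ℝ χb x‖ ≤ C₁) → (∀ x, ‖iteratedFDeriv ℝ 2 χb x‖ ≤ C₂) →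
        ContDiff ℝ 3 U →
        (∀ y : EuclideanSpace ℝ (Fin 3), ‖y‖ < 5 * R → VectorCalculus.divergence U y = 0) →
        (∀ y : EuclideanSpace ℝ (Fin 3), ‖y‖ ≤ 4 * R → ‖U y‖ ≤ Cu / (1 + ‖y‖)) →
        (∀ y : EuclideanSpace ℝ (Fin 3), ‖y‖ ≤ 4 * R → ‖fderiv ℝ U y‖ ≤ K / (1 + ‖y‖) ^ 2) →
        (∀ y : EuclideanSpace ℝ (Fin 3), ‖y‖ ≤ 4 * R →
          ‖iteratedFDeriv ℝ 2 U y‖ ≤ K₂ / (1 + ‖y‖) ^ 3) →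
        (χ = fun y => χb (R⁻¹ • y)) → (η = fun y => χ y ^ 2) →
        (∫ y, χ y ^ 2 * ‖curl U y‖ ^ 2 ≤ θ ^ 2) →
        -(1 / 2) * (∫ y, χ y ^ 2 * ‖curl U y‖ ^ 2) +
            (∫ y, (1 / 2 * fderiv ℝ η y y + (Δ η) y + fderiv ℝ η y (U y)) * ‖curl U y‖ ^ 2) -
            2 * (∫ y, χ y ^ 2 * frobeniusNormSq (fderiv ℝ (curl U) y)) +
            2 * (∫ y, χ y ^ 2 * ⟪curl U y, fderiv ℝ U y (curl U y)⟫) ≤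
          -(1 / 4) * (∫ y, χ y ^ 2 * ‖curl U y‖ ^ 2) + θ ^ 2 / 16 := by
  -- the universal constants
  obtain ⟨a, ha⟩ : ∃ a : ℝ,
      (eLpNormLESNormFDerivOfEqInnerConst (volume : Measure (EuclideanSpace ℝ (Fin 3))) 2 : ℝ) + 1 = a :=
    ⟨_, rfl⟩
  have ha1 : 1 ≤ a := by
    rw [← ha]
    linarith [NNReal.coe_nonneg (eLpNormLESNormFDerivOfEqInnerConst
      (volume : Measure (EuclideanSpace ℝ (Fin 3))) 2)]
  have ha0 : 0 < a := by linarith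
  obtain ⟨κ, hκ⟩ : ∃ κ : ℝ, ‖curlCLM‖ = κ := ⟨_, rfl⟩
  obtain ⟨τ, hτ⟩ : ∃ τ : ℝ,
      ‖(traceCLM : (EuclideanSpace ℝ (Fin 3) →L[ℝ] EuclideanSpace ℝ (Fin 3)) →L[ℝ] ℝ)‖ = τ := ⟨_, rfl⟩
  obtain ⟨v₁, hv₁⟩ : ∃ v : ℝ, (volume (ball (0 : EuclideanSpace ℝ (Fin 3)) 1)).toReal = v := ⟨_, rfl⟩
  have hv₁0 : 0 ≤ v₁ := by rw [← hv₁]; exact ENNReal.toReal_nonneg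
  refine ⟨1 / (7 * a ^ 3), by positivity, ?_, ?_⟩
  · rw [div_le_one (by positivity)]
    nlinarith [one_le_pow₀ (n := 3) ha1]
  intro θ hθ hθϑ Cu K K₂ C₁ C₂ hCu hK hK₂ hC₁0 hC₂0
  have hθa : θ * a ^ 3 ≤ 1 / 7 := by
    have h := mul_le_mul_of_nonneg_right hθϑ (by positivity : (0 : ℝ) ≤ a ^ 3)
    rwa [div_mul_eq_mul_div, one_mul, mul_comm (7 : ℝ), ← div_div, div_self (by positivity)] at h
  -- the coefficient `P` of `1/R` in the cut-off errors
  obtain ⟨P, hP⟩ : ∃ P : ℝ,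
      1 / 7 * (3 / 4 * ((κ ^ 2 + τ ^ 2) * (K + C₁ * Cu) ^ 2 * (64 * v₁)) +
          9 / 4 * ((3 * κ ^ 2 + τ ^ 2) * (K₂ + 2 * C₁ * K + C₂ * Cu) ^ 2 * (64 * v₁) +
            128 * C₁ ^ 2 * κ ^ 2 * K ^ 2 * v₁)) +
        (2 * C₁ + 6 * (C₂ + C₁ ^ 2) + 2 * C₁ * Cu) * κ ^ 2 * K ^ 2 * (64 * v₁) = P := ⟨_, rfl⟩
  have hP0 : 0 ≤ P := by rw [← hP]; positivity
  refine ⟨max 1 (16 * P / θ ^ 2), le_max_left _ _, ?_⟩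
  intro R hR χb U χ η hχb hχb1 hχb0 hχb01 hC₁ hC₂ hU hdiv h0 h1 h2 hχ hη hF
  have hR1 : 1 ≤ R := (le_max_left _ _).trans hR
  have hR0 : 0 < R := by linarith
  have hPR : P / R ≤ θ ^ 2 / 16 := by
    have h1 : 16 * P / θ ^ 2 ≤ R := (le_max_right _ _).trans hR
    rw [div_le_iff₀ (by positivity)] at h1
    rw [div_le_iff₀ hR0]
    linarith
  -- name the quantities of the slice
  obtain ⟨F2, hF2⟩ : ∃ F2 : ℝ, (∫ y, χ y ^ 2 * ‖curl U y‖ ^ 2) = F2 := ⟨_, rfl⟩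
  obtain ⟨D2, hD2⟩ : ∃ D2 : ℝ, (∫ y, χ y ^ 2 * frobeniusNormSq (fderiv ℝ (curl U) y)) = D2 := ⟨_, rfl⟩
  obtain ⟨E, hE⟩ : ∃ E : ℝ,
      (∫ y, (1 / 2 * fderiv ℝ η y y + (Δ η) y + fderiv ℝ η y (U y)) * ‖curl U y‖ ^ 2) = E := ⟨_, rfl⟩
  obtain ⟨S, hS⟩ : ∃ S : ℝ, 2 * (∫ y, χ y ^ 2 * ⟪curl U y, fderiv ℝ U y (curl U y)⟫) = S := ⟨_, rfl⟩
  have hF2_0 : 0 ≤ F2 := by rw [← hF2]; exact integral_nonneg fun y => by positivity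
  have hD2_0 : 0 ≤ D2 := by
    rw [← hD2]; exact integral_nonneg fun y => mul_nonneg (sq_nonneg _) (frobeniusNormSq_nonneg _)
  rw [hF2] at hF
  -- the two estimates
  have hSt := abs_integral_stretch_le (χS := fun y => χb ((2 * R)⁻¹ • y))
    (V := fun y => χb ((2 * R)⁻¹ • y) • U y) hχb hχb1 hχb0 hχb01 hC₁0 hC₂0 hC₁ hC₂ hR1 hU hdiv hCu
    hK hK₂ h0 h1 h2 rfl hχ rfl hθ.le (by rw [hF2]; exact hF)
  have hEt := abs_integral_Eterm_le hχb hχb1 hχb0 hχb01 hC₁0 hC₂0 hC₁ hC₂ hR1 hU hCu hK h0 h1 hχ hη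
  rw [hF2, hD2, hS, hκ, hτ, volume_real_closedBall_four_mul hR0.le, hv₁, ha] at hSt
  rw [hE, hκ, volume_real_closedBall_four_mul hR0.le, hv₁] at hEt
  rw [hF2, hD2, hE, hS]
  -- the cut-off errors are `≤ P / R`
  have hR3 : R ≤ R ^ 3 := by nlinarith
  have e1 : (κ ^ 2 * ((K + C₁ * Cu) / R ^ 2) ^ 2 + τ ^ 2 * ((K + C₁ * Cu) / R ^ 2) ^ 2) *
      (64 * R ^ 3 * v₁) = ((κ ^ 2 + τ ^ 2) * (K + C₁ * Cu) ^ 2 * (64 * v₁)) / R := by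
    field_simp
  have e2 : (3 * κ ^ 2 * ((K₂ + 2 * C₁ * K + C₂ * Cu) / R ^ 3) ^ 2 +
      τ ^ 2 * ((K₂ + 2 * C₁ * K + C₂ * Cu) / R ^ 3) ^ 2) * (64 * R ^ 3 * v₁) =
      ((3 * κ ^ 2 + τ ^ 2) * (K₂ + 2 * C₁ * K + C₂ * Cu) ^ 2 * (64 * v₁)) / R ^ 3 := by
    field_simp
  have e2' : ((3 * κ ^ 2 + τ ^ 2) * (K₂ + 2 * C₁ * K + C₂ * Cu) ^ 2 * (64 * v₁)) / R ^ 3 ≤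
      ((3 * κ ^ 2 + τ ^ 2) * (K₂ + 2 * C₁ * K + C₂ * Cu) ^ 2 * (64 * v₁)) / R :=
    div_le_div_of_nonneg_left (by positivity) hR0 hR3
  have e3 : 2 * (C₁ / R) ^ 2 * (κ ^ 2 * (K / R ^ 2) ^ 2) * (64 * R ^ 3 * v₁) =
      (128 * C₁ ^ 2 * κ ^ 2 * K ^ 2 * v₁) / R ^ 3 := by
    field_simp; ring
  have e3' : (128 * C₁ ^ 2 * κ ^ 2 * K ^ 2 * v₁) / R ^ 3 ≤ (128 * C₁ ^ 2 * κ ^ 2 * K ^ 2 * v₁) / R :=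
    div_le_div_of_nonneg_left (by positivity) hR0 hR3
  have e4 : (2 * C₁ + 6 * (C₂ + C₁ ^ 2) + 2 * C₁ * Cu) * (κ ^ 2 * (K / R ^ 2) ^ 2) * (64 * R ^ 3 * v₁) =
      ((2 * C₁ + 6 * (C₂ + C₁ ^ 2) + 2 * C₁ * Cu) * κ ^ 2 * K ^ 2 * (64 * v₁)) / R := by
    field_simp
  rw [e1, e2, e3] at hSt
  rw [e4] at hEt
  -- abbreviations for the four error sizes
  obtain ⟨A₁, hA₁⟩ : ∃ A : ℝ, (κ ^ 2 + τ ^ 2) * (K + C₁ * Cu) ^ 2 * (64 * v₁) = A := ⟨_, rfl⟩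
  obtain ⟨A₂, hA₂⟩ : ∃ A : ℝ, (3 * κ ^ 2 + τ ^ 2) * (K₂ + 2 * C₁ * K + C₂ * Cu) ^ 2 * (64 * v₁) = A :=
    ⟨_, rfl⟩
  obtain ⟨A₃, hA₃⟩ : ∃ A : ℝ, 128 * C₁ ^ 2 * κ ^ 2 * K ^ 2 * v₁ = A := ⟨_, rfl⟩
  obtain ⟨A₄, hA₄⟩ : ∃ A : ℝ, (2 * C₁ + 6 * (C₂ + C₁ ^ 2) + 2 * C₁ * Cu) * κ ^ 2 * K ^ 2 * (64 * v₁) = A :=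
    ⟨_, rfl⟩
  rw [hA₁, hA₂, hA₃] at hSt
  rw [hA₁, hA₂, hA₃, hA₄] at hP
  rw [hA₂] at e2'
  rw [hA₃] at e3'
  rw [hA₄] at hEt
  have hA₁0 : 0 ≤ A₁ := by rw [← hA₁]; positivity
  have hA₂0 : 0 ≤ A₂ := by rw [← hA₂]; positivity
  have hA₃0 : 0 ≤ A₃ := by rw [← hA₃]; positivity
  -- from `|S| ≤ …` and `|E| ≤ …`
  have hS' : S ≤ θ * a ^ 3 * (3 / 2 * F2 + 27 / 4 * D2 + 3 / 4 * (A₁ / R) + 9 / 4 * (A₂ / R ^ 3 + A₃ / R ^ 3)) :=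
    (le_abs_self S).trans hSt
  have hE' : E ≤ A₄ / R := (le_abs_self E).trans hEt
  -- bound the bracket using `θ a³ ≤ 1/7`
  have hbr0 : 0 ≤ 3 / 2 * F2 + 27 / 4 * D2 + 3 / 4 * (A₁ / R) + 9 / 4 * (A₂ / R ^ 3 + A₃ / R ^ 3) := by
    positivity
  have hS'' : S ≤ 1 / 7 * (3 / 2 * F2 + 27 / 4 * D2 + 3 / 4 * (A₁ / R) + 9 / 4 * (A₂ / R + A₃ / R)) := by
    refine hS'.trans ?_
    calc θ * a ^ 3 * (3 / 2 * F2 + 27 / 4 * D2 + 3 / 4 * (A₁ / R) + 9 / 4 * (A₂ / R ^ 3 + A₃ / R ^ 3))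
        ≤ 1 / 7 * (3 / 2 * F2 + 27 / 4 * D2 + 3 / 4 * (A₁ / R) + 9 / 4 * (A₂ / R ^ 3 + A₃ / R ^ 3)) :=
          mul_le_mul_of_nonneg_right hθa hbr0
      _ ≤ 1 / 7 * (3 / 2 * F2 + 27 / 4 * D2 + 3 / 4 * (A₁ / R) + 9 / 4 * (A₂ / R + A₃ / R)) := by
          gcongr
  -- the smalls are `P / R`
  have hsm : 1 / 7 * (3 / 4 * (A₁ / R) + 9 / 4 * (A₂ / R + A₃ / R)) + A₄ / R = P / R := by
    rw [← hP]
    field_simp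
  linarith [hsm, hS'', hE', hPR, hF2_0, hD2_0]

end SliceMain

end Literature.Analysis.FluidPDE

end
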